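import Mathlib.Analysis.SpecialFunctions.ImproperIntegrals
import Literature.Analysis.FluidPDE.SingularKernelGradient
import HarnessLib

/-!
# Hölder continuity of the gradient of singular potentials of Hölder densities

Topic `Literature/Analysis/FluidPDE`. Third part of the regularity theory of
`SingularKernelTruncation.lean` / `SingularKernelGradient.lean`: for a kernel `K` of degree
`−2` which is `C²` off the origin with `‖∇²K(z)‖ ≤ A|z|⁻⁴` (`IsC2SingularKernel`; the Biot–Savart
kernel `K₃`, Majda–Bertozzi, *Vorticity and Incompressible Flow* (CUP 2002), (4.30)–(4.31)) and a
`γ`-Hölder density `f`, `0 < γ < 1`, supported in `B̄(x₀, ρ)`, the gradient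
`∇v = gradPotential K x₀ ρ f` of `v = ∫ K(· − y) f(y) dy` is `γ`-Hölder on the ball `B(x₀, ρ/2)`
with an explicit constant times `([f]_γ + ‖f‖_∞)`: the local form of Majda–Bertozzi §4.1.3
**Lemma 4.6, (4.36)** "`|P_N f|_γ ≤ c ‖f‖_γ`" (with (4.49): `∇v = P₃ f + c f`), i.e. of
Gilbarg–Trudinger §4.3 **Lemma 4.4**, (4.18) (`[D²w]_{α} ≤ C [f]_α` for the Newtonian potential).

## The argument (Gilbarg–Trudinger, proof of Lemma 4.4, in smooth-cutoff form)

For `x, x̄ ∈ B(x₀, ρ/2)`, `δ = |x − x̄| ≤ ρ/8`, `ξ = (x + x̄)/2`, split the first term of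
`gradPotential` with the local cutoff `ψ = θ_δ(· − ξ)` (`= 1` on `B̄(ξ, δ)`, `= 0` off `B(ξ, 2δ)`):
the near parts `∫ ψ (∇K(x−y)·)(f y − f x) dy` are `O(A [f]_γ δ^γ/γ)` (`holderMajorant`, as in the
`C¹` theory); on the far part, where `|y − ξ| ≥ δ` and every point `w` of the segment
`[x − y, x̄ − y]` has `|w| ≥ |ξ − y|/2`,
`(∇K(x−y)·)(f y − χ y f x) − (∇K(x̄−y)·)(f y − χ y f x̄)
 = ((∇K(x−y) − ∇K(x̄−y))·)(f y − χ y f x) + χ(y) (∇K(x̄−y)·)(f x̄ − f x)`;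
the first difference is `≤ 16 A δ |ξ − y|⁻⁴ · 2[f]_γ |ξ − y|^γ` near the support (mean value with
the `∇²K` bound), integrating to `O(A [f]_γ δ^γ/(1 − γ))` over `|y − ξ| ≥ δ`
(`∫_{|z|≥δ} |z|^{γ−4} = 4π δ^{γ−1}/(1−γ)`), and `O(A ‖f‖_∞ δ/ρ)` on the cutoff shell; in the
second, after one integration by parts the factor `∫ (1 − ψ) χ ∇K(x̄ − y) dy = ∫ ∇((1−ψ)χ)(y) ⊗ K(x̄−y) dy`
is bounded independently of `δ` (`|∇ψ| ≤ B/δ` on the shell `δ ≤ |y − ξ| ≤ 2δ`, where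
`|K(x̄ − y)| ≤ 4A δ⁻²`, of volume `≤ 32π δ³/3`) — the smooth cutoff makes the classical
cancellation `∫_{∂B} D_iΓ ν_j = const` unnecessary. The cutoff term
`∫ ∇χ(y) ⊗ (K(x−y) f(x) − K(x̄−y) f(x̄)) dy` is `O(δ^γ)` directly (`∇χ` lives at distance
`≥ ρ/2`). All `ρ`-dependent terms of the resulting bound are of the form `δ/ρ ≤ δ^γ ρ^{−γ}`,
so for the global statement one simply inflates `ρ` (given `supp f ⊆ B̄(x₀, R)` and any pair
`x, x̄`, the radius `ρ = 8|x − x̄| + R + 2|x − x₀| + 2|x̄ − x₀|` is admissible), which yields a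
Hölder constant `c₁(A, B, γ) [f]_γ + c₂(A, B) ‖f‖_∞ R^{−γ}` on all of `ℝ³`.

## Contents (all proved)

* `IsC2SingularKernel K A` (extends `IsC1SingularKernel`; second derivatives stated
  directionally), the midpoint geometry (`mid`, `norm_ge_of_mem_segment`) and the mean value
  bounds `norm_kernel_sub_kernel_le`, `norm_fderiv_kernel_sub_le`;
* the near part `norm_integral_nearGrad_le`; the exterior majorant `extMajorant` with
  `integral_extMajorant` (`= 4π δ^{γ−1}/(1−γ)`); the far difference `norm_integral_far_diff_le`;
  the integration-by-parts term `norm_integral_far_ibp_le` (via `farCutoff`,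
  `norm_fderiv_farCutoff_mul_le`, `integral_smul_fderiv_truncKernel`); the cutoff term
  `norm_integral_cutoffTerm_sub_le`, `norm_integral_cutoffTerm_le`;
* `norm_gradPotential_sub_le` — the local estimate on `B(x₀, ρ/2)`;
* `norm_gradPotential_le`, `norm_fderiv_singularPotential_le_far`,
  `norm_fderiv_singularPotential_le` — sup bounds (`≤ A C 4π(8R)^γ/γ + (256π/3) A M + (128π/3) A B M`);
* `norm_fderiv_singularPotential_sub_le`, `holderWith_fderiv_singularPotential` — the global
  Hölder estimate with constants `holderGradConstC A B γ`, `holderGradConstM A B`.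

## References

* D. Gilbarg, N. S. Trudinger, *Elliptic PDE of Second Order* (2001), §4.3 Lemma 4.4, (4.18).
  [GilbargTrudinger2001]
* A. J. Majda, A. L. Bertozzi, *Vorticity and Incompressible Flow* (CUP 2002), §4.1.3 Lemma 4.6
  (4.35)–(4.36), (4.49). [MajdaBertozziCUP2002]
-/

noncomputable section

open MeasureTheory Set Function Filter Metric Real
open _root_.Topology
open scoped ENNReal NNReal

namespace Literature.Analysis.FluidPDE

/-- Local notation for physical space `ℝ³ = EuclideanSpace ℝ (Fin 3)`. -/
local notation "ℝ³" => EuclideanSpace ℝ (Fin 3)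

variable {V W : Type*} [NormedAddCommGroup V] [NormedSpace ℝ V] [NormedAddCommGroup W]
  [NormedSpace ℝ W]

/-! ### `C²` singular kernels -/

/-- **Singular kernels of degree `−2` with two derivatives**: an `IsC1SingularKernel` which is
`C²` off the origin with `‖∇²K(z)‖ ≤ A (‖z‖⁴)⁻¹` (Majda–Bertozzi (4.31): `P_N = ∇K_N` smooth off
`0` and homogeneous of degree `−N`, so `∇P_N` is homogeneous of degree `−N − 1`;
Gilbarg–Trudinger (2.14) `|D²Γ| ≤ C|x|^{−n}`, `|D³Γ| ≤ C|x|^{−n−1}`). [folklore] -/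
structure IsC2SingularKernel (K : ℝ³ → V →L[ℝ] W) (A : ℝ) : Prop
    extends IsC1SingularKernel K A where
  /-- Each directional derivative `w ↦ ∇K(w) e` is differentiable off the origin. -/
  differentiableAt_fderiv_apply : ∀ z : ℝ³, z ≠ 0 → ∀ e : ℝ³,
    DifferentiableAt ℝ (fun w => fderiv ℝ K w e) z
  /-- Size of the second derivative, directionally: `‖∇(∇K(·) e)(z)‖ ≤ A ‖e‖ |z|⁻⁴` off the
  origin (stated direction by direction; in this Mathlib pin the thrice-iterated operator space
  `ℝ³ →L ℝ³ →L V →L W` carries no norm instance). -/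
  norm_fderiv_fderiv_apply_le : ∀ z : ℝ³, z ≠ 0 → ∀ e : ℝ³,
    ‖fderiv ℝ (fun w => fderiv ℝ K w e) z‖ ≤ A * ‖e‖ * (‖z‖ ^ 4)⁻¹

/-! ### Geometry of the split: midpoint and segments away from the singularity -/

/-- The midpoint `ξ = (x + x̄)/2`. [folklore] -/
def mid (x x' : ℝ³) : ℝ³ := (2 : ℝ)⁻¹ • (x + x')

/-- `x − ξ = (x − x̄)/2`. [folklore] -/
theorem sub_mid (x x' : ℝ³) : x - mid x x' = (2 : ℝ)⁻¹ • (x - x') := by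
  simp only [mid]
  module

/-- `x̄ − ξ = −(x − x̄)/2`. [folklore] -/
theorem sub_mid' (x x' : ℝ³) : x' - mid x x' = -((2 : ℝ)⁻¹ • (x - x')) := by
  have h := sub_mid x' x
  rw [mid, add_comm] at h
  rw [mid, h, ← smul_neg, neg_sub]

/-- `‖x − ξ‖ = ‖x − x̄‖/2`. [folklore] -/
theorem norm_sub_mid (x x' : ℝ³) : ‖x - mid x x'‖ = ‖x - x'‖ / 2 := by
  rw [sub_mid, norm_smul, norm_inv, Real.norm_two, inv_mul_eq_div]

/-- `‖x̄ − ξ‖ = ‖x − x̄‖/2`. [folklore] -/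
theorem norm_sub_mid' (x x' : ℝ³) : ‖x' - mid x x'‖ = ‖x - x'‖ / 2 := by
  rw [sub_mid', norm_neg, norm_smul, norm_inv, Real.norm_two, inv_mul_eq_div]

/-- **Points of the segment `[x − y, x̄ − y]` stay away from the origin**: if `|y − ξ| ≥ δ ≥ |x − x̄|`
then every `w` on the segment has `‖w‖ ≥ ‖ξ − y‖/2` (`w − (ξ − y)` is a multiple `(t − ½)(x − x̄)`
of norm `≤ δ/2 ≤ ‖ξ − y‖/2`). [folklore] -/
theorem norm_ge_of_mem_segment {x x' y : ℝ³} {δ : ℝ} (hδ : ‖x - x'‖ ≤ δ) (hy : δ ≤ ‖y - mid x x'‖)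
    {w : ℝ³} (hw : w ∈ segment ℝ (x' - y) (x - y)) : ‖mid x x' - y‖ / 2 ≤ ‖w‖ := by
  rw [segment_eq_image'] at hw
  obtain ⟨t, ht, rfl⟩ := hw
  -- `w = (x' - y) + t • ((x - y) - (x' - y))`
  have hrepr : (x' - y) + t • ((x - y) - (x' - y)) - (mid x x' - y) = (t - 2⁻¹) • (x - x') := by
    rw [sub_sub_sub_cancel_right, sub_smul]
    have h1 : x' - y - (mid x x' - y) = x' - mid x x' := by abel
    calc x' - y + t • (x - x') - (mid x x' - y) = (x' - mid x x') + t • (x - x') := by abel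
      _ = -((2 : ℝ)⁻¹ • (x - x')) + t • (x - x') := by rw [sub_mid']
      _ = t • (x - x') - (2 : ℝ)⁻¹ • (x - x') := by abel
  have hsmall : ‖(x' - y) + t • ((x - y) - (x' - y)) - (mid x x' - y)‖ ≤ ‖mid x x' - y‖ / 2 := by
    rw [hrepr, norm_smul, Real.norm_eq_abs]
    have ht' : |t - 2⁻¹| ≤ 2⁻¹ := by
      rw [abs_le]
      constructor <;> linarith [ht.1, ht.2]
    calc |t - 2⁻¹| * ‖x - x'‖ ≤ 2⁻¹ * δ := by gcongr
      _ ≤ ‖mid x x' - y‖ / 2 := by rw [norm_sub_rev] at hy; linarith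
  have := norm_sub_norm_le (mid x x' - y) ((x' - y) + t • ((x - y) - (x' - y)))
  rw [norm_sub_rev (mid x x' - y)] at this
  linarith

/-- **Mean value bound for the kernel along a segment away from the origin**: under the
hypotheses of `norm_ge_of_mem_segment`,
`‖K(x − y) − K(x̄ − y)‖ ≤ A (‖ξ−y‖/2)⁻³ ‖x − x̄‖`. [folklore] -/
theorem norm_kernel_sub_kernel_le {K : ℝ³ → V →L[ℝ] W} {A : ℝ} (hK : IsC1SingularKernel K A)
    {x x' y : ℝ³} {δ : ℝ} (hδpos : 0 < δ) (hδ : ‖x - x'‖ ≤ δ) (hy : δ ≤ ‖y - mid x x'‖) :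
    ‖K (x - y) - K (x' - y)‖ ≤ A * ((‖mid x x' - y‖ / 2) ^ 3)⁻¹ * ‖x - x'‖ := by
  have hA := hK.nonneg
  have hm : 0 < ‖mid x x' - y‖ / 2 := by rw [norm_sub_rev] at hy; linarith
  have hseg : ∀ w ∈ segment ℝ (x' - y) (x - y), ‖mid x x' - y‖ / 2 ≤ ‖w‖ := fun w hw =>
    norm_ge_of_mem_segment hδ hy hw
  have hne : ∀ w ∈ segment ℝ (x' - y) (x - y), w ≠ 0 := fun w hw h0 => by
    have := hseg w hw
    rw [h0, norm_zero] at this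
    linarith
  have h := Convex.norm_image_sub_le_of_norm_fderiv_le (f := K) (𝕜 := ℝ)
    (fun w hw => hK.differentiableAt (hne w hw))
    (fun w hw => (hK.norm_fderiv_le w (hne w hw)).trans
      (mul_le_mul_of_nonneg_left (inv_anti₀ (by positivity) (pow_le_pow_left₀ hm.le (hseg w hw) 3)) hA))
    (convex_segment (x' - y) (x - y)) (left_mem_segment ℝ _ _) (right_mem_segment ℝ _ _)
  rwa [sub_sub_sub_cancel_right] at h

/-- **Mean value bound for the derivative of the kernel along a segment away from the origin**:
`‖∇K(x − y) − ∇K(x̄ − y)‖ ≤ A (‖ξ−y‖/2)⁻⁴ ‖x − x̄‖`. [folklore] -/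
theorem norm_fderiv_kernel_sub_le {K : ℝ³ → V →L[ℝ] W} {A : ℝ} (hK : IsC2SingularKernel K A)
    {x x' y : ℝ³} {δ : ℝ} (hδpos : 0 < δ) (hδ : ‖x - x'‖ ≤ δ) (hy : δ ≤ ‖y - mid x x'‖) :
    ‖fderiv ℝ K (x - y) - fderiv ℝ K (x' - y)‖ ≤ A * ((‖mid x x' - y‖ / 2) ^ 4)⁻¹ * ‖x - x'‖ := by
  have hA := hK.nonneg
  have hm : 0 < ‖mid x x' - y‖ / 2 := by rw [norm_sub_rev] at hy; linarith
  have hseg : ∀ w ∈ segment ℝ (x' - y) (x - y), ‖mid x x' - y‖ / 2 ≤ ‖w‖ := fun w hw =>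
    norm_ge_of_mem_segment hδ hy hw
  have hne : ∀ w ∈ segment ℝ (x' - y) (x - y), w ≠ 0 := fun w hw h0 => by
    have := hseg w hw
    rw [h0, norm_zero] at this
    linarith
  refine ContinuousLinearMap.opNorm_le_bound _ (by positivity) fun e => ?_
  rw [sub_apply]
  have h := Convex.norm_image_sub_le_of_norm_fderiv_le (f := fun w => fderiv ℝ K w e) (𝕜 := ℝ)
    (fun w hw => hK.differentiableAt_fderiv_apply w (hne w hw) e)
    (fun w hw => (hK.norm_fderiv_fderiv_apply_le w (hne w hw) e).trans
      (mul_le_mul_of_nonneg_left (inv_anti₀ (by positivity) (pow_le_pow_left₀ hm.le (hseg w hw) 4))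
        (by positivity)))
    (convex_segment (x' - y) (x - y)) (left_mem_segment ℝ _ _) (right_mem_segment ℝ _ _)
  rw [sub_sub_sub_cancel_right] at h
  calc ‖fderiv ℝ K (x - y) e - fderiv ℝ K (x' - y) e‖
      ≤ A * ‖e‖ * ((‖mid x x' - y‖ / 2) ^ 4)⁻¹ * ‖x - x'‖ := h
    _ = A * ((‖mid x x' - y‖ / 2) ^ 4)⁻¹ * ‖x - x'‖ * ‖e‖ := by ring

/-! ### Integration by parts against a general cutoff -/

section IBP

variable {K : ℝ³ → V →L[ℝ] W} {A : ℝ}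

/-- **Integration by parts in `y` against a `C¹` compactly supported scalar `φ`**:
`∫ φ(y) • (∇K_ε(x − y) e) v dy = ∫ (∂ₑφ)(y) • K_ε(x − y) v dy` (generalises
`integral_suppCutoff_smul_fderiv_truncKernel` from `χ` to any `φ`). [folklore] -/
theorem integral_smul_fderiv_truncKernel (hK : IsC1SingularKernel K A) {ε : ℝ} (hε : 0 < ε)
    {φ : ℝ³ → ℝ} (hφ : ContDiff ℝ 1 φ) (hφc : HasCompactSupport φ) (x : ℝ³) (v : V) (e : ℝ³) :
    ∫ y, φ y • (fderiv ℝ (truncKernel K ε) (x - y) e) v =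
      ∫ y, (fderiv ℝ φ y e) • (truncKernel K ε (x - y) v) := by
  have hKc : ContDiff ℝ 1 (truncKernel K ε) := contDiff_truncKernel hK hε
  have hGc : ContDiff ℝ 1 (fun y : ℝ³ => truncKernel K ε (x - y) v) :=
    (hKc.comp (contDiff_const.sub contDiff_id)).clm_apply contDiff_const
  have hGd : ∀ y, fderiv ℝ (fun y : ℝ³ => truncKernel K ε (x - y) v) y e =
      -((fderiv ℝ (truncKernel K ε) (x - y) e) v) := by
    intro y
    have h1 : HasFDerivAt (truncKernel K ε) (fderiv ℝ (truncKernel K ε) (x - y)) (x - y) :=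
      ((hKc.differentiable one_ne_zero) _).hasFDerivAt
    have h2 : HasFDerivAt (fun y : ℝ³ => x - y) (-(ContinuousLinearMap.id ℝ ℝ³)) y :=
      ((hasFDerivAt_const x y).sub (hasFDerivAt_id y)).congr_fderiv (by simp)
    have h3 : HasFDerivAt (fun y : ℝ³ => truncKernel K ε (x - y) v) _ y :=
      (h1.comp y h2).clm_apply (hasFDerivAt_const v y)
    rw [h3.fderiv]
    simp
  have i1 : Integrable fun y => fderiv ℝ φ y e • truncKernel K ε (x - y) v :=
    (((hφ.continuous_fderiv one_ne_zero).clm_apply continuous_const).smul hGc.continuous)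
      |>.integrable_of_hasCompactSupport ((hφc.fderiv_apply (𝕜 := ℝ) e).smul_right)
  have i2 : Integrable fun y => φ y • fderiv ℝ (fun y : ℝ³ => truncKernel K ε (x - y) v) y e :=
    (hφ.continuous.smul ((hGc.continuous_fderiv one_ne_zero).clm_apply continuous_const))
      |>.integrable_of_hasCompactSupport hφc.smul_right
  have i3 : Integrable fun y => φ y • truncKernel K ε (x - y) v :=
    (hφ.continuous.smul hGc.continuous).integrable_of_hasCompactSupport hφc.smul_right
  have key := integral_smul_fderiv_eq_neg_fderiv_smul_of_integrable (𝕜 := ℝ) (μ := volume)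
    (f := φ) (g := fun y : ℝ³ => truncKernel K ε (x - y) v) (v := e) i1 i2 i3
    (fun y _ => (hφ.differentiable one_ne_zero) y) (fun y _ => (hGc.differentiable one_ne_zero) y)
  have hl : ∫ y, φ y • (fderiv ℝ (truncKernel K ε) (x - y) e) v =
      -∫ y, φ y • fderiv ℝ (fun y : ℝ³ => truncKernel K ε (x - y) v) y e := by
    rw [← integral_neg]
    refine integral_congr_ae (Eventually.of_forall fun y => ?_)
    simp only [hGd, smul_neg, neg_neg]
  rw [hl, key, neg_neg]

end IBP

/-! ### The near part of the split -/

section Near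

variable {K : ℝ³ → V →L[ℝ] W} {A : ℝ}

/-- **Where the local cutoff lives**: if `ψ(y) = θ_δ(y − ξ) ≠ 0`-relevant, i.e. `‖y − ξ‖ < 2δ`,
`x ∈ B(x₀, ρ/2)`, `‖x − x̄‖ ≤ δ ≤ ρ/8`, then `‖x − y‖ < 3δ` and `‖y − x₀‖ ≤ ρ`. [folklore] -/
theorem near_geometry {x x' y x₀ : ℝ³} {δ ρ : ℝ} (hx : ‖x - x₀‖ < ρ / 2) (hδ0 : 0 < δ)
    (hδ : ‖x - x'‖ ≤ δ) (hδρ : δ ≤ ρ / 8) (hy : ‖y - mid x x'‖ < 2 * δ) :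
    ‖x - y‖ < 3 * δ ∧ ‖y - x₀‖ ≤ ρ := by
  have h1 : ‖x - y‖ ≤ ‖x - mid x x'‖ + ‖mid x x' - y‖ := norm_sub_le_norm_sub_add_norm_sub _ _ _
  rw [norm_sub_mid, norm_sub_rev (mid x x') y] at h1
  have hxy : ‖x - y‖ < 3 * δ := by linarith
  refine ⟨hxy, ?_⟩
  have h2 : ‖y - x₀‖ ≤ ‖y - x‖ + ‖x - x₀‖ := norm_sub_le_norm_sub_add_norm_sub _ _ _
  rw [norm_sub_rev y x] at h2
  linarith [norm_nonneg (x - x₀)]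

/-- **The near part is `O(δ^γ)`**: for `x ∈ B(x₀, ρ/2)`, `‖x − x̄‖ ≤ δ ≤ ρ/8`,
`‖∫ θ_δ(y − ξ) • (∇K(x−y) ·)(f y − χ y • f x) dy‖ ≤ A [f]_γ · 4π (3δ)^γ/γ` (on the support of the
local cutoff `χ = 1`, the Hölder bound `A C |x − y|^{γ−3}` applies, and `|x − y| < 3δ`). [folklore] -/
theorem norm_integral_nearGrad_le (hK : IsC1SingularKernel K A) {γ C : ℝ≥0} (hγ : 0 < γ) {f : ℝ³ → V}
    (hf : HolderWith C γ f) {x₀ : ℝ³} {ρ : ℝ} (hρ : 0 < ρ) {x x' : ℝ³} (hx : ‖x - x₀‖ < ρ / 2)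
    {δ : ℝ} (hδ0 : 0 < δ) (hδ : ‖x - x'‖ ≤ δ) (hδρ : δ ≤ ρ / 8) :
    ‖∫ y, suppCutoff (mid x x') δ y • (fderiv ℝ K (x - y)).flip (f y - suppCutoff x₀ ρ y • f x)‖ ≤
      A * C * (4 * π * (3 * δ) ^ (γ : ℝ) / γ) := by
  have hA := hK.nonneg
  have hc0 : 0 ≤ A * C := by positivity
  have hpt : ∀ y, ‖suppCutoff (mid x x') δ y • (fderiv ℝ K (x - y)).flip (f y - suppCutoff x₀ ρ y • f x)‖ ≤
      A * C * holderMajorant γ (3 * δ) (x - y) := by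
    intro y
    by_cases hψ : ‖y - mid x x'‖ < 2 * δ
    · obtain ⟨hxy, hyρ⟩ := near_geometry hx hδ0 hδ hδρ hψ
      rw [suppCutoff_eq_one hρ hyρ, one_smul, norm_smul, Real.norm_eq_abs]
      have hmaj : holderMajorant γ (3 * δ) (x - y) = ‖x - y‖ ^ ((γ : ℝ) - 3) := by
        simp [holderMajorant, indicator, hxy]
      rcases eq_or_ne x y with hxy' | hxy'
      · subst hxy'
        simp only [sub_self, map_zero, norm_zero, mul_zero]
        exact mul_nonneg hc0 (holderMajorant_nonneg _ _ _)
      · have h := norm_flip_apply_sub_le_of_holderWith hxy' (hK.norm_fderiv_le _ (sub_ne_zero.2 hxy')) hf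
        calc |suppCutoff (mid x x') δ y| * ‖(fderiv ℝ K (x - y)).flip (f y - f x)‖
            ≤ 1 * (A * C * ‖x - y‖ ^ ((γ : ℝ) - 3)) := by
              gcongr
              exact abs_suppCutoff_le_one _ _ _
          _ = A * C * holderMajorant γ (3 * δ) (x - y) := by rw [hmaj, one_mul]
    · rw [suppCutoff_eq_zero hδ0 (not_lt.1 hψ), zero_smul, norm_zero]
      exact mul_nonneg hc0 (holderMajorant_nonneg _ _ _)
  have h1 : ‖∫ y, suppCutoff (mid x x') δ y • (fderiv ℝ K (x - y)).flip (f y - suppCutoff x₀ ρ y • f x)‖ₑ ≤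
      ENNReal.ofReal (A * C * (4 * π * (3 * δ) ^ (γ : ℝ) / γ)) := by
    refine (enorm_integral_le_lintegral_enorm _).trans ?_
    have h2 := lintegral_mono (μ := (volume : Measure ℝ³)) fun y =>
      (show ‖suppCutoff (mid x x') δ y • (fderiv ℝ K (x - y)).flip (f y - suppCutoff x₀ ρ y • f x)‖ₑ ≤
          ENNReal.ofReal (A * C) * ENNReal.ofReal (holderMajorant γ (3 * δ) (x - y)) from by
        rw [← ofReal_norm, ← ENNReal.ofReal_mul hc0]
        exact ENNReal.ofReal_le_ofReal (hpt y))
    refine h2.trans ?_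
    have hmk : Measurable fun y : ℝ³ => ENNReal.ofReal (holderMajorant γ (3 * δ) (x - y)) :=
      ((measurable_holderMajorant γ (3 * δ)).comp (measurable_const.sub measurable_id)).ennreal_ofReal
    rw [lintegral_const_mul _ hmk,
      lintegral_sub_left_eq_self (μ := (volume : Measure ℝ³))
        (fun z => ENNReal.ofReal (holderMajorant γ (3 * δ) z)) x,
      lintegral_holderMajorant (by exact_mod_cast hγ) (by positivity), ← ENNReal.ofReal_mul hc0]
  rw [← ofReal_norm] at h1
  exact (ENNReal.ofReal_le_ofReal_iff (by positivity)).1 h1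

end Near

/-! ### The exterior radial integral `∫_{|z| ≥ δ} |z|^{γ−4} dz = 4π δ^{γ−1}/(1 − γ)` -/

/-- The exterior Hölder majorant `1_{|z| ≥ δ} |z|^{γ−4}`. [folklore] -/
def extMajorant (γ δ : ℝ) (z : ℝ³) : ℝ :=
  (ball (0 : ℝ³) δ)ᶜ.indicator (fun z => ‖z‖ ^ (γ - 4)) z

/-- The exterior majorant is nonnegative. [folklore] -/
theorem extMajorant_nonneg (γ δ : ℝ) (z : ℝ³) : 0 ≤ extMajorant γ δ z := by
  unfold extMajorant
  exact indicator_nonneg (fun _ _ => Real.rpow_nonneg (norm_nonneg _) _) z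

/-- The exterior majorant is measurable. [folklore] -/
theorem measurable_extMajorant (γ δ : ℝ) : Measurable (extMajorant γ δ) := by
  unfold extMajorant
  exact Measurable.indicator (measurable_norm.pow_const _) measurableSet_ball.compl

/-- Off the ball of radius `δ`, `extMajorant γ δ z = ‖z‖^{γ−4}`. [folklore] -/
theorem extMajorant_eq {γ δ : ℝ} {z : ℝ³} (hz : δ ≤ ‖z‖) : extMajorant γ δ z = ‖z‖ ^ (γ - 4) := by
  unfold extMajorant
  rw [indicator_of_mem]
  simpa using hz

/-- The exterior majorant as a radial profile: `extMajorant γ δ z = (1_{[δ,∞)} s^{γ−4})(‖z‖)`. [folklore] -/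
theorem extMajorant_eq_profile (γ δ : ℝ) :
    extMajorant γ δ = fun z : ℝ³ => (Ici δ).indicator (fun s : ℝ => s ^ (γ - 4)) ‖z‖ := by
  funext z
  by_cases hz : δ ≤ ‖z‖
  · rw [extMajorant_eq hz, indicator_of_mem (mem_Ici.2 hz)]
  · unfold extMajorant
    rw [indicator_of_notMem (by simpa using lt_of_not_ge hz), indicator_of_notMem (by simpa using hz)]

/-- **`1_{|z|≥δ} |z|^{γ−4}` is integrable on `ℝ³`** for `γ < 1`, `δ > 0` (polar coordinates:
`s² s^{γ−4} = s^{γ−2}` is integrable on `[δ, ∞)` since `γ − 2 < −1`). [folklore] -/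
theorem integrable_extMajorant {γ δ : ℝ} (hγ : γ < 1) (hδ : 0 < δ) : Integrable (extMajorant γ δ) := by
  rw [extMajorant_eq_profile, integrable_fun_norm_addHaar (μ := (volume : Measure ℝ³)),
    finrank_euclideanSpace_fin]
  have h1 : EqOn (fun y : ℝ => y ^ (3 - 1) • (Ici δ).indicator (fun s : ℝ => s ^ (γ - 4)) y)
      ((Ici δ).indicator fun y : ℝ => y ^ (γ - 2)) (Ioi 0) := by
    intro y hy
    have hy0 : (0 : ℝ) < y := hy
    by_cases hyδ : δ ≤ y
    · simp only [indicator_of_mem (mem_Ici.2 hyδ), smul_eq_mul]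
      rw [show ((3 : ℕ) - 1 : ℕ) = 2 by norm_num, ← Real.rpow_natCast y 2, ← Real.rpow_add hy0]
      norm_num
      ring_nf
    · simp [indicator_of_notMem (show y ∉ Ici δ from fun h => hyδ h)]
  refine (IntegrableOn.congr_fun ?_ h1.symm measurableSet_Ioi)
  rw [integrableOn_indicator_iff measurableSet_Ici, inter_eq_left.2 (Ici_subset_Ioi.2 hδ),
    integrableOn_Ici_iff_integrableOn_Ioi]
  exact integrableOn_Ioi_rpow_of_lt (by linarith) hδ

/-- **Polar coordinates: `∫_{|z| ≥ δ} |z|^{γ−4} dz = 4π δ^{γ−1}/(1 − γ)`** (`γ < 1`, `δ > 0`):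
`3 |B₁| ∫_δ^∞ s² s^{γ−4} ds = 4π ∫_δ^∞ s^{γ−2} ds = 4π δ^{γ−1}/(1−γ)` (Mathlib
`integral_Ioi_rpow_of_lt`; cf. `NewtonPotentialHolder.integral_compl_ball_norm_rpow_neg`, the
same computation with `|B₁|` left symbolic). [folklore] -/
theorem integral_extMajorant {γ δ : ℝ} (hγ : γ < 1) (hδ : 0 < δ) :
    ∫ z, extMajorant γ δ z = 4 * π * δ ^ (γ - 1) / (1 - γ) := by
  rw [extMajorant_eq_profile, integral_fun_norm_addHaar (volume : Measure ℝ³)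
    (fun s : ℝ => (Ici δ).indicator (fun s : ℝ => s ^ (γ - 4)) s), finrank_euclideanSpace_fin]
  have hinner : ∫ s in Ioi (0 : ℝ), s ^ (3 - 1) • (Ici δ).indicator (fun s : ℝ => s ^ (γ - 4)) s =
      δ ^ (γ - 1) / (1 - γ) := by
    have h1 : EqOn (fun y : ℝ => y ^ (3 - 1) • (Ici δ).indicator (fun s : ℝ => s ^ (γ - 4)) y)
        ((Ici δ).indicator fun y : ℝ => y ^ (γ - 2)) (Ioi 0) := by
      intro y hy
      have hy0 : (0 : ℝ) < y := hy
      by_cases hyδ : δ ≤ y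
      · simp only [indicator_of_mem (mem_Ici.2 hyδ), smul_eq_mul]
        rw [show ((3 : ℕ) - 1 : ℕ) = 2 by norm_num, ← Real.rpow_natCast y 2, ← Real.rpow_add hy0]
        norm_num
        ring_nf
      · simp [indicator_of_notMem (show y ∉ Ici δ from fun h => hyδ h)]
    rw [setIntegral_congr_fun measurableSet_Ioi h1, setIntegral_indicator measurableSet_Ici,
      inter_eq_right.2 (Ici_subset_Ioi.2 hδ), integral_Ici_eq_integral_Ioi,
      integral_Ioi_rpow_of_lt (by linarith) hδ]
    rw [show γ - 2 + 1 = γ - 1 by ring]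
    have hγ1 : γ - 1 ≠ 0 := by linarith
    have h1γ : 1 - γ ≠ 0 := by linarith
    rw [div_eq_div_iff hγ1 h1γ]
    ring
  rw [hinner, measureReal_def, EuclideanSpace.volume_ball_fin_three]
  rw [ENNReal.toReal_mul, ← ENNReal.ofReal_pow zero_le_one, one_pow, ENNReal.toReal_ofReal zero_le_one,
    ENNReal.toReal_ofReal (by positivity : (0 : ℝ) ≤ π * 4 / 3)]
  simp only [nsmul_eq_mul, smul_eq_mul]
  have h1γ : (1 - γ) ≠ 0 := by linarith
  field_simp
  ring

/-- The lower Lebesgue integral of the exterior majorant. [folklore] -/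
theorem lintegral_extMajorant {γ δ : ℝ} (hγ : γ < 1) (hδ : 0 < δ) :
    ∫⁻ z, ENNReal.ofReal (extMajorant γ δ z) = ENNReal.ofReal (4 * π * δ ^ (γ - 1) / (1 - γ)) := by
  rw [← integral_extMajorant hγ hδ, ofReal_integral_eq_lintegral_ofReal
    (integrable_extMajorant hγ hδ) (Eventually.of_forall (extMajorant_nonneg γ δ))]

/-! ### The far part: integrability and the mean-value term `I₁` -/

section Far

variable {K : ℝ³ → V →L[ℝ] W} {A : ℝ}

/-- `0 ≤ 1 − ψ ≤ 1` for the local cutoff. [folklore] -/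
theorem abs_one_sub_suppCutoff_le (ξ : ℝ³) (δ : ℝ) (y : ℝ³) : |1 - suppCutoff ξ δ y| ≤ 1 := by
  have h0 : 0 ≤ suppCutoff ξ δ y := radialCutoff_nonneg _ _ _
  have h1 : suppCutoff ξ δ y ≤ 1 := radialCutoff_le_one _ _ _
  rw [abs_le]
  constructor <;> linarith

/-- Where `1 − ψ ≠ 0` one is at distance `> δ` from `ξ`, hence `> δ/2` from any point `x̄` with
`‖x̄ − ξ‖ ≤ δ/2`. [folklore] -/
theorem dist_of_one_sub_suppCutoff_ne_zero {ξ x' y : ℝ³} {δ : ℝ} (hδ0 : 0 < δ) (hx' : ‖x' - ξ‖ ≤ δ / 2)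
    (h : 1 - suppCutoff ξ δ y ≠ 0) : δ < ‖y - ξ‖ ∧ δ / 2 < ‖x' - y‖ := by
  have hy : δ < ‖y - ξ‖ := by
    by_contra hle
    exact h (by rw [suppCutoff_eq_one hδ0 (not_lt.1 hle), sub_self])
  refine ⟨hy, ?_⟩
  have : ‖y - ξ‖ ≤ ‖y - x'‖ + ‖x' - ξ‖ := norm_sub_le_norm_sub_add_norm_sub _ _ _
  rw [norm_sub_rev y x'] at this
  linarith

/-- **The far pieces are integrable**: for a continuous compactly supported `g` and `x̄` within
`δ/2` of the centre of the local cutoff, `y ↦ (1 − ψ(y)) • (∇K(x̄ − y) ·)(g y)` is integrable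
(the factor `1 − ψ` vanishes near the singularity `y = x̄`, where `‖∇K(x̄ − y)‖ ≤ 8A δ⁻³`
elsewhere on its support). [folklore] -/
theorem integrable_far_piece (hK : IsC1SingularKernel K A) {ξ x' : ℝ³} {δ : ℝ} (hδ0 : 0 < δ)
    (hx' : ‖x' - ξ‖ ≤ δ / 2) {g : ℝ³ → V} (hg : Continuous g) (hgc : HasCompactSupport g) :
    Integrable fun y => (1 - suppCutoff ξ δ y) • (fderiv ℝ K (x' - y)).flip (g y) := by
  have hA := hK.nonneg
  have hψc : Continuous fun y => 1 - suppCutoff ξ δ y :=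
    continuous_const.sub (contDiff_suppCutoff ξ δ (n := 0)).continuous
  refine Integrable.mono' (((hg.norm).const_mul (8 * A * (δ ^ 3)⁻¹)).integrable_of_hasCompactSupport
      (hgc.norm.mul_left)) (hψc.aestronglyMeasurable.smul (aestronglyMeasurable_fderiv_flip_apply hK hg x'))
    (Eventually.of_forall fun y => ?_)
  by_cases h : 1 - suppCutoff ξ δ y = 0
  · rw [h, zero_smul, norm_zero]
    positivity
  · obtain ⟨-, hxy⟩ := dist_of_one_sub_suppCutoff_ne_zero hδ0 hx' h
    have hxy0 : x' - y ≠ 0 := by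
      intro h0; rw [h0, norm_zero] at hxy; linarith
    rw [norm_smul, Real.norm_eq_abs]
    have hD : ‖fderiv ℝ K (x' - y)‖ ≤ 8 * A * (δ ^ 3)⁻¹ := by
      refine (hK.norm_fderiv_le _ hxy0).trans ?_
      have : (‖x' - y‖ ^ 3)⁻¹ ≤ ((δ / 2) ^ 3)⁻¹ :=
        inv_anti₀ (by positivity) (pow_le_pow_left₀ (by positivity) hxy.le 3)
      calc A * (‖x' - y‖ ^ 3)⁻¹ ≤ A * ((δ / 2) ^ 3)⁻¹ := by gcongr
        _ = 8 * A * (δ ^ 3)⁻¹ := by field_simp; ring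
    calc |1 - suppCutoff ξ δ y| * ‖(fderiv ℝ K (x' - y)).flip (g y)‖
        ≤ 1 * (‖(fderiv ℝ K (x' - y)).flip‖ * ‖g y‖) := by
          gcongr
          · exact abs_one_sub_suppCutoff_le _ _ _
          · exact ContinuousLinearMap.le_opNorm _ _
      _ = ‖fderiv ℝ K (x' - y)‖ * ‖g y‖ := by rw [one_mul, ContinuousLinearMap.opNorm_flip]
      _ ≤ 8 * A * (δ ^ 3)⁻¹ * ‖g y‖ := by gcongr

/-- The midpoint of two points of `B(x₀, ρ/2)` lies in `B(x₀, ρ/2)`. [folklore] -/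
theorem norm_mid_sub_lt {x x' x₀ : ℝ³} {ρ : ℝ} (hx : ‖x - x₀‖ < ρ / 2) (hx' : ‖x' - x₀‖ < ρ / 2) :
    ‖mid x x' - x₀‖ < ρ / 2 := by
  have hrepr : mid x x' - x₀ = (2 : ℝ)⁻¹ • (x - x₀) + (2 : ℝ)⁻¹ • (x' - x₀) := by
    simp only [mid]
    module
  rw [hrepr]
  calc ‖(2 : ℝ)⁻¹ • (x - x₀) + (2 : ℝ)⁻¹ • (x' - x₀)‖
      ≤ ‖(2 : ℝ)⁻¹ • (x - x₀)‖ + ‖(2 : ℝ)⁻¹ • (x' - x₀)‖ := norm_add_le _ _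
    _ = ‖x - x₀‖ / 2 + ‖x' - x₀‖ / 2 := by
        rw [norm_smul, norm_smul, norm_inv, Real.norm_two]; ring
    _ < ρ / 2 := by linarith

/-- `t^γ (t⁴)⁻¹ = t^{γ−4}` for `t > 0`. [folklore] -/
theorem rpow_mul_inv_pow_four {t : ℝ} (ht : 0 < t) (γ : ℝ) : t ^ γ * (t ^ 4)⁻¹ = t ^ (γ - 4) := by
  rw [Real.rpow_sub ht, show (4 : ℝ) = ((4 : ℕ) : ℝ) by norm_num, Real.rpow_natCast, div_eq_mul_inv]

/-- `(3/2)^γ ≤ 3/2` for `γ ≤ 1`. [folklore] -/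
theorem three_halves_rpow_le {γ : ℝ} (hγ1 : γ ≤ 1) : (3 / 2 : ℝ) ^ γ ≤ 3 / 2 := by
  have h := Real.rpow_le_rpow_of_exponent_le (by norm_num : (1 : ℝ) ≤ 3 / 2) hγ1
  rwa [Real.rpow_one] at h

/-- **The mean-value term `I₁` of the far part is `O(δ^γ)`**: for `x, x̄ ∈ B(x₀, ρ/2)`,
`‖x − x̄‖ ≤ δ ≤ ρ/8`, `0 < γ < 1`,
`‖∫ (1 − ψ y) • ((∇K(x−y) − ∇K(x̄−y)) ·)(f y − χ y • f x) dy‖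
  ≤ 96π A [f]_γ δ^γ/(1 − γ) + (8192π/3) A ‖f‖_∞ δ/ρ`
(on `B̄(x₀, ρ)` the Hölder bound and `norm_fderiv_kernel_sub_le` give `24 A C δ |ξ − y|^{γ−4}`,
integrated with `lintegral_extMajorant`; on the cutoff shell `f = 0`, `|ξ − y| > ρ/2`, giving
`256 A M δ ρ⁻⁴` on a set of volume `32πρ³/3`; Gilbarg–Trudinger, proof of Lemma 4.4, the terms
`I₅`, `I₂`). [folklore] -/
theorem norm_integral_far_diff_le (hK : IsC2SingularKernel K A) {γ C : ℝ≥0} (hγ : 0 < γ)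
    (hγ1 : (γ : ℝ) < 1) {f : ℝ³ → V} (hf : HolderWith C γ f) {x₀ : ℝ³} {ρ M : ℝ} (hρ : 0 < ρ)
    (hsupp : tsupport f ⊆ closedBall x₀ ρ) (hM : ∀ y, ‖f y‖ ≤ M) {x x' : ℝ³} (hx : ‖x - x₀‖ < ρ / 2)
    (hx' : ‖x' - x₀‖ < ρ / 2) {δ : ℝ} (hδ0 : 0 < δ) (hδ : ‖x - x'‖ ≤ δ) :
    ‖∫ y, (1 - suppCutoff (mid x x') δ y) •
        ((fderiv ℝ K (x - y) - fderiv ℝ K (x' - y)).flip (f y - suppCutoff x₀ ρ y • f x))‖ ≤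
      96 * π * A * C * δ ^ (γ : ℝ) / (1 - γ) + 8192 * π / 3 * A * M * δ / ρ := by
  have hA := hK.nonneg
  have hM0 : 0 ≤ M := (norm_nonneg _).trans (hM x)
  have hξ : ‖mid x x' - x₀‖ < ρ / 2 := norm_mid_sub_lt hx hx'
  set c₁ : ℝ := 24 * A * C * δ with hc₁
  set c₂ : ℝ := 256 * A * M * δ * (ρ ^ 4)⁻¹ with hc₂
  have hc₁0 : 0 ≤ c₁ := by positivity
  have hc₂0 : 0 ≤ c₂ := by positivity
  -- pointwise domination
  have hpt : ∀ y, ‖(1 - suppCutoff (mid x x') δ y) •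
      ((fderiv ℝ K (x - y) - fderiv ℝ K (x' - y)).flip (f y - suppCutoff x₀ ρ y • f x))‖ ≤
      c₁ * extMajorant γ δ (mid x x' - y) + c₂ * (closedBall x₀ (2 * ρ)).indicator (fun _ => (1 : ℝ)) y := by
    intro y
    have ht1 : 0 ≤ c₁ * extMajorant γ δ (mid x x' - y) := mul_nonneg hc₁0 (extMajorant_nonneg _ _ _)
    have ht2 : 0 ≤ c₂ * (closedBall x₀ (2 * ρ)).indicator (fun _ => (1 : ℝ)) y :=
      mul_nonneg hc₂0 (indicator_nonneg (fun _ _ => zero_le_one) _)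
    by_cases h : 1 - suppCutoff (mid x x') δ y = 0
    · rw [h, zero_smul, norm_zero]
      exact add_nonneg ht1 ht2
    · obtain ⟨hyξ, -⟩ := dist_of_one_sub_suppCutoff_ne_zero hδ0 (by rw [norm_sub_mid']; linarith) h
      have hyξ' : δ ≤ ‖y - mid x x'‖ := hyξ.le
      have hDiff := norm_fderiv_kernel_sub_le hK hδ0 hδ hyξ'
      have hξy : 0 < ‖mid x x' - y‖ := by rw [norm_sub_rev]; linarith
      -- `‖∇K(x−y) − ∇K(x̄−y)‖ ≤ 16 A δ |ξ − y|⁻⁴`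
      have hD16 : ‖fderiv ℝ K (x - y) - fderiv ℝ K (x' - y)‖ ≤ 16 * A * δ * (‖mid x x' - y‖ ^ 4)⁻¹ := by
        refine hDiff.trans ?_
        have : A * ((‖mid x x' - y‖ / 2) ^ 4)⁻¹ * ‖x - x'‖ ≤ A * ((‖mid x x' - y‖ / 2) ^ 4)⁻¹ * δ := by gcongr
        refine this.trans (le_of_eq ?_)
        field_simp
        ring
      rw [norm_smul, Real.norm_eq_abs]
      by_cases hyρ : ‖y - x₀‖ ≤ ρ
      · -- near the support: Hölder bound
        rw [suppCutoff_eq_one hρ hyρ, one_smul]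
        have hg : ‖f y - f x‖ ≤ C * ((3 / 2) * ‖mid x x' - y‖ ^ (γ : ℝ)) := by
          have h1 : ‖f y - f x‖ ≤ C * ‖y - x‖ ^ (γ : ℝ) := by
            rw [← dist_eq_norm, ← dist_eq_norm]; exact hf.dist_le y x
          have h2 : ‖y - x‖ ≤ (3 / 2) * ‖mid x x' - y‖ := by
            have : ‖y - x‖ ≤ ‖y - mid x x'‖ + ‖mid x x' - x‖ := norm_sub_le_norm_sub_add_norm_sub _ _ _
            rw [norm_sub_rev (mid x x') x, norm_sub_mid, norm_sub_rev y (mid x x')] at this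
            have hrev : ‖y - mid x x'‖ = ‖mid x x' - y‖ := norm_sub_rev _ _
            linarith
          have h3 : ‖y - x‖ ^ (γ : ℝ) ≤ ((3 / 2) * ‖mid x x' - y‖) ^ (γ : ℝ) :=
            Real.rpow_le_rpow (norm_nonneg _) h2 γ.coe_nonneg
          have h4 : ((3 / 2) * ‖mid x x' - y‖) ^ (γ : ℝ) ≤ (3 / 2) * ‖mid x x' - y‖ ^ (γ : ℝ) := by
            rw [Real.mul_rpow (by norm_num) (norm_nonneg _)]
            gcongr
            exact three_halves_rpow_le hγ1.le
          calc ‖f y - f x‖ ≤ C * ‖y - x‖ ^ (γ : ℝ) := h1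
            _ ≤ C * ((3 / 2) * ‖mid x x' - y‖ ^ (γ : ℝ)) := by gcongr; exact h3.trans h4
        refine le_trans ?_ (le_add_of_nonneg_right ht2)
        rw [extMajorant_eq (by rw [norm_sub_rev]; exact hyξ'), ← rpow_mul_inv_pow_four hξy]
        calc |1 - suppCutoff (mid x x') δ y| *
              ‖(fderiv ℝ K (x - y) - fderiv ℝ K (x' - y)).flip (f y - f x)‖
            ≤ 1 * (‖(fderiv ℝ K (x - y) - fderiv ℝ K (x' - y)).flip‖ * ‖f y - f x‖) := by
              gcongr
              · exact abs_one_sub_suppCutoff_le _ _ _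
              · exact ContinuousLinearMap.le_opNorm _ _
          _ = ‖fderiv ℝ K (x - y) - fderiv ℝ K (x' - y)‖ * ‖f y - f x‖ := by
              rw [one_mul, ContinuousLinearMap.opNorm_flip]
          _ ≤ (16 * A * δ * (‖mid x x' - y‖ ^ 4)⁻¹) * (C * ((3 / 2) * ‖mid x x' - y‖ ^ (γ : ℝ))) := by
              gcongr
          _ = c₁ * (‖mid x x' - y‖ ^ (γ : ℝ) * (‖mid x x' - y‖ ^ 4)⁻¹) := by rw [hc₁]; ring
      · -- the cutoff shell (or beyond): `f y = 0`
        have hfy : f y = 0 := by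
          have : y ∉ tsupport f := fun h' => hyρ (by
            have := hsupp h'
            rwa [mem_closedBall, dist_eq_norm] at this)
          exact image_eq_zero_of_notMem_tsupport this
        by_cases hy2 : ‖y - x₀‖ < 2 * ρ
        · have hind : (closedBall x₀ (2 * ρ)).indicator (fun _ => (1 : ℝ)) y = 1 := by
            rw [indicator_of_mem]; rw [mem_closedBall, dist_eq_norm]; exact hy2.le
          rw [hind, mul_one] at ht2 ⊢
          refine le_trans ?_ (le_add_of_nonneg_left ht1)
          have hξy2 : ρ / 2 < ‖mid x x' - y‖ := by
            have : ‖y - x₀‖ ≤ ‖y - mid x x'‖ + ‖mid x x' - x₀‖ := norm_sub_le_norm_sub_add_norm_sub _ _ _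
            rw [norm_sub_rev y (mid x x')] at this
            linarith [not_le.1 hyρ]
          have hD256 : ‖fderiv ℝ K (x - y) - fderiv ℝ K (x' - y)‖ ≤ 256 * A * δ * (ρ ^ 4)⁻¹ := by
            refine hD16.trans ?_
            have : (‖mid x x' - y‖ ^ 4)⁻¹ ≤ ((ρ / 2) ^ 4)⁻¹ :=
              inv_anti₀ (by positivity) (pow_le_pow_left₀ (by positivity) hξy2.le 4)
            calc 16 * A * δ * (‖mid x x' - y‖ ^ 4)⁻¹ ≤ 16 * A * δ * ((ρ / 2) ^ 4)⁻¹ := by gcongr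
              _ = 256 * A * δ * (ρ ^ 4)⁻¹ := by field_simp; ring
          rw [hfy, zero_sub, map_neg, norm_neg, map_smul, norm_smul, Real.norm_eq_abs]
          calc |1 - suppCutoff (mid x x') δ y| *
                (|suppCutoff x₀ ρ y| * ‖(fderiv ℝ K (x - y) - fderiv ℝ K (x' - y)).flip (f x)‖)
              ≤ 1 * (1 * (‖(fderiv ℝ K (x - y) - fderiv ℝ K (x' - y)).flip‖ * ‖f x‖)) := by
                gcongr
                · exact abs_one_sub_suppCutoff_le _ _ _
                · exact abs_suppCutoff_le_one _ _ _
                · exact ContinuousLinearMap.le_opNorm _ _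
            _ = ‖fderiv ℝ K (x - y) - fderiv ℝ K (x' - y)‖ * ‖f x‖ := by
                rw [one_mul, one_mul, ContinuousLinearMap.opNorm_flip]
            _ ≤ 256 * A * δ * (ρ ^ 4)⁻¹ * M := by gcongr; exact hM x
            _ = c₂ := by rw [hc₂]; ring
        · rw [hfy, suppCutoff_eq_zero hρ (not_lt.1 hy2), zero_smul, sub_zero, map_zero, norm_zero,
            mul_zero]
          exact add_nonneg ht1 ht2
  -- integrate
  have h1 : ‖∫ y, (1 - suppCutoff (mid x x') δ y) •
      ((fderiv ℝ K (x - y) - fderiv ℝ K (x' - y)).flip (f y - suppCutoff x₀ ρ y • f x))‖ₑ ≤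
      ENNReal.ofReal (96 * π * A * C * δ ^ (γ : ℝ) / (1 - γ) + 8192 * π / 3 * A * M * δ / ρ) := by
    refine (enorm_integral_le_lintegral_enorm _).trans ?_
    have h2 := lintegral_mono (μ := (volume : Measure ℝ³)) fun y =>
      (show ‖(1 - suppCutoff (mid x x') δ y) •
          ((fderiv ℝ K (x - y) - fderiv ℝ K (x' - y)).flip (f y - suppCutoff x₀ ρ y • f x))‖ₑ ≤
          ENNReal.ofReal c₁ * ENNReal.ofReal (extMajorant γ δ (mid x x' - y)) +
            ENNReal.ofReal c₂ * (closedBall x₀ (2 * ρ)).indicator (fun _ => (1 : ℝ≥0∞)) y from by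
        rw [← ofReal_norm]
        refine (ENNReal.ofReal_le_ofReal (hpt y)).trans ?_
        rw [ENNReal.ofReal_add (mul_nonneg hc₁0 (extMajorant_nonneg _ _ _))
          (mul_nonneg hc₂0 (indicator_nonneg (fun _ _ => zero_le_one) _)), ENNReal.ofReal_mul hc₁0,
          ENNReal.ofReal_mul hc₂0]
        gcongr
        by_cases hy : y ∈ closedBall x₀ (2 * ρ)
        · rw [indicator_of_mem hy, indicator_of_mem hy, ENNReal.ofReal_one]
        · rw [indicator_of_notMem hy, indicator_of_notMem hy, ENNReal.ofReal_zero])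
    refine h2.trans ?_
    have hmk : Measurable fun y : ℝ³ => ENNReal.ofReal (extMajorant γ δ (mid x x' - y)) :=
      ((measurable_extMajorant γ δ).comp (measurable_const.sub measurable_id)).ennreal_ofReal
    have hmk' : Measurable fun y : ℝ³ => ENNReal.ofReal c₁ * ENNReal.ofReal (extMajorant γ δ (mid x x' - y)) :=
      hmk.const_mul _
    rw [lintegral_add_left hmk', lintegral_const_mul _ hmk,
      lintegral_sub_left_eq_self (μ := (volume : Measure ℝ³))
        (fun z => ENNReal.ofReal (extMajorant γ δ z)) (mid x x'),
      lintegral_extMajorant hγ1 hδ0,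
      lintegral_const_mul _ (measurable_const.indicator measurableSet_closedBall),
      lintegral_indicator measurableSet_closedBall, setLIntegral_const, one_mul,
      EuclideanSpace.volume_closedBall_fin_three, ← ENNReal.ofReal_pow (by positivity : (0:ℝ) ≤ 2 * ρ),
      ← ENNReal.ofReal_mul (p := (2 * ρ) ^ 3) (by positivity),
      ← ENNReal.ofReal_mul hc₁0, ← ENNReal.ofReal_mul hc₂0,
      ← ENNReal.ofReal_add (by positivity) (by positivity)]
    refine ENNReal.ofReal_le_ofReal (le_of_eq ?_)
    have h1γ : (1 - (γ : ℝ)) ≠ 0 := by linarith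
    have hρ0 : ρ ≠ 0 := hρ.ne'
    have hδγ : δ * δ ^ ((γ : ℝ) - 1) = δ ^ (γ : ℝ) := by
      rw [← Real.rpow_one_add' hδ0.le (by linarith), add_sub_cancel]
    rw [hc₁, hc₂]
    field_simp
    rw [← hδγ]
    ring
  rw [← ofReal_norm] at h1
  exact (ENNReal.ofReal_le_ofReal_iff (by positivity)).1 h1

end Far

/-! ### The far part: the integration-by-parts term `I₂` -/

section FarIBP

variable {K : ℝ³ → V →L[ℝ] W} {A : ℝ}

/-- **Derivative bound for the translated cutoff**: `‖∇(suppCutoff c r)(y)‖ ≤ B r⁻¹` with the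
universal cutoff constant `B` (translation invariance, Mathlib `fderiv_comp_sub`). [folklore] -/
theorem norm_fderiv_suppCutoff_le {B : ℝ}
    (hB : ∀ ε : ℝ, 0 < ε → ∀ z : ℝ³, ‖fderiv ℝ (radialCutoff ε (2 * ε)) z‖ ≤ B * ε⁻¹)
    (c : ℝ³) {r : ℝ} (hr : 0 < r) (y : ℝ³) : ‖fderiv ℝ (suppCutoff c r) y‖ ≤ B * r⁻¹ := by
  have h : fderiv ℝ (suppCutoff c r) y = fderiv ℝ (radialCutoff r (2 * r)) (y - c) :=
    fderiv_comp_sub (f := (radialCutoff r (2 * r) : ℝ³ → ℝ)) c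
  rw [h]
  exact hB r hr (y - c)

/-- `∇(suppCutoff c r) = 0` beyond `2r` (where the cutoff vanishes identically). [folklore] -/
theorem fderiv_suppCutoff_eq_zero_of_lt {c : ℝ³} {r : ℝ} (hr : 0 < r) {y : ℝ³} (hy : 2 * r < ‖y - c‖) :
    fderiv ℝ (suppCutoff c r) y = 0 := by
  have hev : suppCutoff c r =ᶠ[𝓝 y] fun _ => 0 := by
    have : {w : ℝ³ | 2 * r < ‖w - c‖} ∈ 𝓝 y :=
      (isOpen_lt continuous_const (continuous_id.sub continuous_const).norm).mem_nhds hy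
    filter_upwards [this] with w hw
    exact suppCutoff_eq_zero hr (le_of_lt hw)
  rw [hev.fderiv_eq]
  exact fderiv_const_apply (0 : ℝ)

/-- The product cutoff `φ = (1 − ψ) χ` with `ψ = suppCutoff ξ δ`, `χ = suppCutoff x₀ ρ`. [folklore] -/
def farCutoff (ξ : ℝ³) (δ : ℝ) (x₀ : ℝ³) (ρ : ℝ) (y : ℝ³) : ℝ :=
  (1 - suppCutoff ξ δ y) * suppCutoff x₀ ρ y

/-- `φ` is `C¹`. [folklore] -/
theorem contDiff_farCutoff (ξ : ℝ³) (δ : ℝ) (x₀ : ℝ³) (ρ : ℝ) : ContDiff ℝ 1 (farCutoff ξ δ x₀ ρ) :=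
  (contDiff_const.sub (contDiff_suppCutoff ξ δ)).mul (contDiff_suppCutoff x₀ ρ)

/-- `φ` has compact support (inside that of `χ`). [folklore] -/
theorem hasCompactSupport_farCutoff (ξ : ℝ³) (δ : ℝ) (x₀ : ℝ³) {ρ : ℝ} (hρ : 0 < ρ) :
    HasCompactSupport (farCutoff ξ δ x₀ ρ) :=
  (hasCompactSupport_suppCutoff x₀ hρ).mul_left

/-- **The key pointwise bound behind the `δ`-independence of the integration-by-parts term**:
for `x̄ ∈ B(x₀, ρ/2)` with `‖x̄ − ξ‖ ≤ δ/2`,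
`‖∇φ(y)‖ ‖K_ε(x̄ − y)‖ ≤ 4AB ρ⁻³ 1_{B̄(x₀,2ρ)}(y) + 4AB δ⁻³ 1_{B̄(ξ,2δ)}(y)` for every `ε`
(`∇χ` lives on `ρ ≤ |y − x₀| ≤ 2ρ` where `|x̄ − y| > ρ/2` and `|∇χ| ≤ B/ρ`; `∇ψ` lives on
`δ ≤ |y − ξ| ≤ 2δ` where `|x̄ − y| ≥ δ/2` and `|∇ψ| ≤ B/δ`; `‖K_ε(z)‖ ≤ A|z|⁻²`). [folklore] -/
theorem norm_fderiv_farCutoff_mul_le (hK : IsC1SingularKernel K A) {B : ℝ} (hB0 : 0 ≤ B)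
    (hB : ∀ ε : ℝ, 0 < ε → ∀ z : ℝ³, ‖fderiv ℝ (radialCutoff ε (2 * ε)) z‖ ≤ B * ε⁻¹)
    {ξ x₀ x' : ℝ³} {δ ρ : ℝ} (hδ0 : 0 < δ) (hρ : 0 < ρ) (hx' : ‖x' - x₀‖ < ρ / 2)
    (hx'ξ : ‖x' - ξ‖ ≤ δ / 2) (ε : ℝ) (y : ℝ³) :
    ‖fderiv ℝ (farCutoff ξ δ x₀ ρ) y‖ * ‖truncKernel K ε (x' - y)‖ ≤
      4 * A * B * (ρ ^ 3)⁻¹ * (closedBall x₀ (2 * ρ)).indicator (fun _ => (1 : ℝ)) y +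
        4 * A * B * (δ ^ 3)⁻¹ * (closedBall ξ (2 * δ)).indicator (fun _ => (1 : ℝ)) y := by
  have hA := hK.nonneg
  have hχd : Differentiable ℝ (suppCutoff x₀ ρ) := (contDiff_suppCutoff x₀ ρ (n := 1)).differentiable one_ne_zero
  have hψd : Differentiable ℝ (suppCutoff ξ δ) := (contDiff_suppCutoff ξ δ (n := 1)).differentiable one_ne_zero
  have hKε : ‖truncKernel K ε (x' - y)‖ ≤ A * (‖x' - y‖ ^ 2)⁻¹ := norm_truncKernel_le hK ε _
  -- product rule and the crude bound `‖∇φ‖ ≤ ‖∇χ‖ + ‖∇ψ‖`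
  have hprod : ‖fderiv ℝ (farCutoff ξ δ x₀ ρ) y‖ ≤
      ‖fderiv ℝ (suppCutoff x₀ ρ) y‖ + ‖fderiv ℝ (suppCutoff ξ δ) y‖ := by
    have h1 : fderiv ℝ (farCutoff ξ δ x₀ ρ) y =
        (1 - suppCutoff ξ δ y) • fderiv ℝ (suppCutoff x₀ ρ) y +
          suppCutoff x₀ ρ y • fderiv ℝ (fun w => 1 - suppCutoff ξ δ w) y := by
      change fderiv ℝ (fun w => (1 - suppCutoff ξ δ w) * suppCutoff x₀ ρ w) y = _
      rw [fderiv_fun_mul ((hψd y).const_sub 1) (hχd y)]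
    rw [h1, fderiv_const_sub]
    calc ‖(1 - suppCutoff ξ δ y) • fderiv ℝ (suppCutoff x₀ ρ) y +
          suppCutoff x₀ ρ y • -fderiv ℝ (suppCutoff ξ δ) y‖
        ≤ ‖(1 - suppCutoff ξ δ y) • fderiv ℝ (suppCutoff x₀ ρ) y‖ +
            ‖suppCutoff x₀ ρ y • -fderiv ℝ (suppCutoff ξ δ) y‖ := norm_add_le _ _
      _ ≤ 1 * ‖fderiv ℝ (suppCutoff x₀ ρ) y‖ + 1 * ‖fderiv ℝ (suppCutoff ξ δ) y‖ := by
          rw [norm_smul, norm_smul, norm_neg, Real.norm_eq_abs, Real.norm_eq_abs]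
          gcongr
          · exact abs_one_sub_suppCutoff_le _ _ _
          · exact abs_suppCutoff_le_one _ _ _
      _ = _ := by rw [one_mul, one_mul]
  -- the `χ` term
  have hT1 : ‖fderiv ℝ (suppCutoff x₀ ρ) y‖ * ‖truncKernel K ε (x' - y)‖ ≤
      4 * A * B * (ρ ^ 3)⁻¹ * (closedBall x₀ (2 * ρ)).indicator (fun _ => (1 : ℝ)) y := by
    by_cases hin : ‖y - x₀‖ < ρ
    · rw [fderiv_suppCutoff_eq_zero hρ hin, norm_zero, zero_mul]
      exact mul_nonneg (by positivity) (indicator_nonneg (fun _ _ => zero_le_one) _)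
    by_cases hout : 2 * ρ < ‖y - x₀‖
    · rw [fderiv_suppCutoff_eq_zero_of_lt hρ hout, norm_zero, zero_mul]
      exact mul_nonneg (by positivity) (indicator_nonneg (fun _ _ => zero_le_one) _)
    · have hyin : y ∈ closedBall x₀ (2 * ρ) := by
        rw [mem_closedBall, dist_eq_norm]; exact not_lt.1 hout
      rw [indicator_of_mem hyin, mul_one]
      have hxy : ρ / 2 < ‖x' - y‖ := by
        have : ‖y - x₀‖ ≤ ‖y - x'‖ + ‖x' - x₀‖ := norm_sub_le_norm_sub_add_norm_sub _ _ _
        rw [norm_sub_rev y x'] at this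
        linarith [not_lt.1 hin]
      have hKb : ‖truncKernel K ε (x' - y)‖ ≤ 4 * A * (ρ ^ 2)⁻¹ := by
        refine hKε.trans ?_
        have : (‖x' - y‖ ^ 2)⁻¹ ≤ ((ρ / 2) ^ 2)⁻¹ :=
          inv_anti₀ (by positivity) (pow_le_pow_left₀ (by positivity) hxy.le 2)
        calc A * (‖x' - y‖ ^ 2)⁻¹ ≤ A * ((ρ / 2) ^ 2)⁻¹ := by gcongr
          _ = 4 * A * (ρ ^ 2)⁻¹ := by field_simp; ring
      calc ‖fderiv ℝ (suppCutoff x₀ ρ) y‖ * ‖truncKernel K ε (x' - y)‖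
          ≤ (B * ρ⁻¹) * (4 * A * (ρ ^ 2)⁻¹) := by
            gcongr
            exact norm_fderiv_suppCutoff_le hB x₀ hρ y
        _ = 4 * A * B * (ρ ^ 3)⁻¹ := by field_simp
  -- the `ψ` term
  have hT2 : ‖fderiv ℝ (suppCutoff ξ δ) y‖ * ‖truncKernel K ε (x' - y)‖ ≤
      4 * A * B * (δ ^ 3)⁻¹ * (closedBall ξ (2 * δ)).indicator (fun _ => (1 : ℝ)) y := by
    by_cases hin : ‖y - ξ‖ < δ
    · rw [fderiv_suppCutoff_eq_zero hδ0 hin, norm_zero, zero_mul]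
      exact mul_nonneg (by positivity) (indicator_nonneg (fun _ _ => zero_le_one) _)
    by_cases hout : 2 * δ < ‖y - ξ‖
    · rw [fderiv_suppCutoff_eq_zero_of_lt hδ0 hout, norm_zero, zero_mul]
      exact mul_nonneg (by positivity) (indicator_nonneg (fun _ _ => zero_le_one) _)
    · have hyin : y ∈ closedBall ξ (2 * δ) := by
        rw [mem_closedBall, dist_eq_norm]; exact not_lt.1 hout
      rw [indicator_of_mem hyin, mul_one]
      have hxy : δ / 2 ≤ ‖x' - y‖ := by
        have : ‖y - ξ‖ ≤ ‖y - x'‖ + ‖x' - ξ‖ := norm_sub_le_norm_sub_add_norm_sub _ _ _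
        rw [norm_sub_rev y x'] at this
        linarith [not_lt.1 hin]
      have hKb : ‖truncKernel K ε (x' - y)‖ ≤ 4 * A * (δ ^ 2)⁻¹ := by
        refine hKε.trans ?_
        have : (‖x' - y‖ ^ 2)⁻¹ ≤ ((δ / 2) ^ 2)⁻¹ :=
          inv_anti₀ (by positivity) (pow_le_pow_left₀ (by positivity) hxy 2)
        calc A * (‖x' - y‖ ^ 2)⁻¹ ≤ A * ((δ / 2) ^ 2)⁻¹ := by gcongr
          _ = 4 * A * (δ ^ 2)⁻¹ := by field_simp; ring
      calc ‖fderiv ℝ (suppCutoff ξ δ) y‖ * ‖truncKernel K ε (x' - y)‖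
          ≤ (B * δ⁻¹) * (4 * A * (δ ^ 2)⁻¹) := by
            gcongr
            exact norm_fderiv_suppCutoff_le hB ξ hδ0 y
        _ = 4 * A * B * (δ ^ 3)⁻¹ := by field_simp
  calc ‖fderiv ℝ (farCutoff ξ δ x₀ ρ) y‖ * ‖truncKernel K ε (x' - y)‖
      ≤ (‖fderiv ℝ (suppCutoff x₀ ρ) y‖ + ‖fderiv ℝ (suppCutoff ξ δ) y‖) * ‖truncKernel K ε (x' - y)‖ := by
        gcongr
    _ = ‖fderiv ℝ (suppCutoff x₀ ρ) y‖ * ‖truncKernel K ε (x' - y)‖ +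
          ‖fderiv ℝ (suppCutoff ξ δ) y‖ * ‖truncKernel K ε (x' - y)‖ := add_mul _ _ _
    _ ≤ _ := add_le_add hT1 hT2

/-- **The integration-by-parts term `I₂` is bounded independently of `δ`**: for
`x, x̄ ∈ B(x₀, ρ/2)`, `‖x − x̄‖ ≤ δ`, `δ ≤ ρ/8`, and any `v ∈ V`,
`‖∫ (1 − ψ y) • (∇K(x̄ − y) ·)(χ(y) • v) dy‖ ≤ (256π/3) A B ‖v‖`. Proof: direction-wise the
integrand is `φ(y) • (∇K(x̄−y) e) v`, `φ = (1 − ψ)χ`; on the support of `φ` the kernel may be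
replaced by its truncation `K_{δ/8}`; integrate by parts (`integral_smul_fderiv_truncKernel`) and
use `norm_fderiv_farCutoff_mul_le` with the volumes `|B̄(x₀,2ρ)| = 32πρ³/3`,
`|B̄(ξ,2δ)| = 32πδ³/3`. [folklore] -/
theorem norm_integral_far_ibp_le (hK : IsC1SingularKernel K A) {B : ℝ} (hB0 : 0 ≤ B)
    (hB : ∀ ε : ℝ, 0 < ε → ∀ z : ℝ³, ‖fderiv ℝ (radialCutoff ε (2 * ε)) z‖ ≤ B * ε⁻¹)
    {x₀ : ℝ³} {ρ : ℝ} (hρ : 0 < ρ) {x x' : ℝ³} (hx' : ‖x' - x₀‖ < ρ / 2)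
    {δ : ℝ} (hδ0 : 0 < δ) (hδ : ‖x - x'‖ ≤ δ) (v : V) :
    ‖∫ y, (1 - suppCutoff (mid x x') δ y) •
        (fderiv ℝ K (x' - y)).flip (suppCutoff x₀ ρ y • v)‖ ≤ 256 * π / 3 * A * B * ‖v‖ := by
  have hA := hK.nonneg
  set ξ : ℝ³ := mid x x' with hξ
  have hx'ξ : ‖x' - ξ‖ ≤ δ / 2 := by rw [hξ, norm_sub_mid']; linarith
  set ε : ℝ := δ / 8 with hε
  have hεpos : 0 < ε := by positivity
  have hχc : ContDiff ℝ 1 (suppCutoff x₀ ρ) := contDiff_suppCutoff x₀ ρ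
  have hχs : HasCompactSupport (suppCutoff x₀ ρ) := hasCompactSupport_suppCutoff x₀ hρ
  have hg : Continuous fun y => suppCutoff x₀ ρ y • v := hχc.continuous.smul continuous_const
  have hgc : HasCompactSupport fun y => suppCutoff x₀ ρ y • v := hχs.smul_right
  have hint : Integrable fun y => (1 - suppCutoff ξ δ y) • (fderiv ℝ K (x' - y)).flip (suppCutoff x₀ ρ y • v) :=
    integrable_far_piece hK hδ0 hx'ξ hg hgc
  refine ContinuousLinearMap.opNorm_le_bound _ (by positivity) fun e => ?_
  rw [ContinuousLinearMap.integral_apply hint e]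
  -- the direction-wise integrand is `φ y • (∇K(x̄ − y) e) v`, and `K` may be truncated there
  have hφ : ∀ y, ((1 - suppCutoff ξ δ y) • (fderiv ℝ K (x' - y)).flip (suppCutoff x₀ ρ y • v)) e =
      farCutoff ξ δ x₀ ρ y • (fderiv ℝ (truncKernel K ε) (x' - y) e) v := by
    intro y
    rw [smul_apply, ContinuousLinearMap.flip_apply, map_smul, smul_smul, farCutoff]
    by_cases h : 1 - suppCutoff ξ δ y = 0
    · rw [h, zero_mul, zero_smul, zero_smul]
    · obtain ⟨-, hxy⟩ := dist_of_one_sub_suppCutoff_ne_zero hδ0 hx'ξ h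
      have hev : truncKernel K ε =ᶠ[𝓝 (x' - y)] K := by
        have hlt : 2 * ε < ‖x' - y‖ := by rw [hε]; linarith
        have : {z : ℝ³ | 2 * ε < ‖z‖} ∈ 𝓝 (x' - y) :=
          (isOpen_lt continuous_const continuous_norm).mem_nhds hlt
        filter_upwards [this] with z hz
        exact truncKernel_eq K hεpos (le_of_lt hz)
      rw [hev.fderiv_eq]
  simp_rw [hφ]
  rw [integral_smul_fderiv_truncKernel hK hεpos (contDiff_farCutoff ξ δ x₀ ρ)
    (hasCompactSupport_farCutoff ξ δ x₀ hρ) x' v e]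
  -- bound the integration-by-parts integral
  set c₁ : ℝ := 4 * A * B * (ρ ^ 3)⁻¹ with hc₁
  set c₂ : ℝ := 4 * A * B * (δ ^ 3)⁻¹ with hc₂
  have hc₁0 : 0 ≤ c₁ := by positivity
  have hc₂0 : 0 ≤ c₂ := by positivity
  have hpt : ∀ y, ‖(fderiv ℝ (farCutoff ξ δ x₀ ρ) y e) • truncKernel K ε (x' - y) v‖ ≤
      (‖e‖ * ‖v‖) * (c₁ * (closedBall x₀ (2 * ρ)).indicator (fun _ => (1 : ℝ)) y +
        c₂ * (closedBall ξ (2 * δ)).indicator (fun _ => (1 : ℝ)) y) := by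
    intro y
    have hkey := norm_fderiv_farCutoff_mul_le hK hB0 hB (ξ := ξ) hδ0 hρ hx' hx'ξ ε y
    rw [norm_smul, Real.norm_eq_abs]
    calc |fderiv ℝ (farCutoff ξ δ x₀ ρ) y e| * ‖truncKernel K ε (x' - y) v‖
        ≤ (‖fderiv ℝ (farCutoff ξ δ x₀ ρ) y‖ * ‖e‖) * (‖truncKernel K ε (x' - y)‖ * ‖v‖) := by
          gcongr
          · rw [← Real.norm_eq_abs]; exact ContinuousLinearMap.le_opNorm _ _
          · exact ContinuousLinearMap.le_opNorm _ _
      _ = (‖e‖ * ‖v‖) * (‖fderiv ℝ (farCutoff ξ δ x₀ ρ) y‖ * ‖truncKernel K ε (x' - y)‖) := by ring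
      _ ≤ (‖e‖ * ‖v‖) * (c₁ * (closedBall x₀ (2 * ρ)).indicator (fun _ => (1 : ℝ)) y +
            c₂ * (closedBall ξ (2 * δ)).indicator (fun _ => (1 : ℝ)) y) := by
          gcongr
  have h1 : ‖∫ y, (fderiv ℝ (farCutoff ξ δ x₀ ρ) y e) • truncKernel K ε (x' - y) v‖ₑ ≤
      ENNReal.ofReal (256 * π / 3 * A * B * ‖v‖ * ‖e‖) := by
    refine (enorm_integral_le_lintegral_enorm _).trans ?_
    have h2 := lintegral_mono (μ := (volume : Measure ℝ³)) fun y =>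
      (show ‖(fderiv ℝ (farCutoff ξ δ x₀ ρ) y e) • truncKernel K ε (x' - y) v‖ₑ ≤
          ENNReal.ofReal (‖e‖ * ‖v‖) * (ENNReal.ofReal c₁ * (closedBall x₀ (2 * ρ)).indicator (fun _ => (1 : ℝ≥0∞)) y +
            ENNReal.ofReal c₂ * (closedBall ξ (2 * δ)).indicator (fun _ => (1 : ℝ≥0∞)) y) from by
        rw [← ofReal_norm]
        refine (ENNReal.ofReal_le_ofReal (hpt y)).trans ?_
        rw [ENNReal.ofReal_mul (by positivity),
          ENNReal.ofReal_add (mul_nonneg hc₁0 (indicator_nonneg (fun _ _ => zero_le_one) _))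
            (mul_nonneg hc₂0 (indicator_nonneg (fun _ _ => zero_le_one) _)),
          ENNReal.ofReal_mul hc₁0, ENNReal.ofReal_mul hc₂0]
        gcongr
        · by_cases hy : y ∈ closedBall x₀ (2 * ρ)
          · rw [indicator_of_mem hy, indicator_of_mem hy, ENNReal.ofReal_one]
          · rw [indicator_of_notMem hy, indicator_of_notMem hy, ENNReal.ofReal_zero]
        · by_cases hy : y ∈ closedBall ξ (2 * δ)
          · rw [indicator_of_mem hy, indicator_of_mem hy, ENNReal.ofReal_one]
          · rw [indicator_of_notMem hy, indicator_of_notMem hy, ENNReal.ofReal_zero])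
    refine h2.trans ?_
    have hm₁ : Measurable fun y : ℝ³ => ENNReal.ofReal c₁ * (closedBall x₀ (2 * ρ)).indicator (fun _ => (1 : ℝ≥0∞)) y :=
      (measurable_const.indicator measurableSet_closedBall).const_mul _
    rw [lintegral_const_mul' _ _ ENNReal.ofReal_ne_top, lintegral_add_left hm₁,
      lintegral_const_mul _ (measurable_const.indicator measurableSet_closedBall),
      lintegral_const_mul _ (measurable_const.indicator measurableSet_closedBall),
      lintegral_indicator measurableSet_closedBall, lintegral_indicator measurableSet_closedBall,
      setLIntegral_const, setLIntegral_const, one_mul, one_mul,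
      EuclideanSpace.volume_closedBall_fin_three, EuclideanSpace.volume_closedBall_fin_three,
      ← ENNReal.ofReal_pow (by positivity : (0:ℝ) ≤ 2 * ρ), ← ENNReal.ofReal_pow (by positivity : (0:ℝ) ≤ 2 * δ),
      ← ENNReal.ofReal_mul (p := (2 * ρ) ^ 3) (by positivity), ← ENNReal.ofReal_mul (p := (2 * δ) ^ 3) (by positivity),
      ← ENNReal.ofReal_mul hc₁0, ← ENNReal.ofReal_mul hc₂0,
      ← ENNReal.ofReal_add (by positivity) (by positivity), ← ENNReal.ofReal_mul (by positivity)]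
    refine ENNReal.ofReal_le_ofReal (le_of_eq ?_)
    rw [hc₁, hc₂]
    field_simp
    ring
  rw [← ofReal_norm] at h1
  exact (ENNReal.ofReal_le_ofReal_iff (by positivity)).1 h1

end FarIBP

/-! ### The cutoff term `T₂ = ∫ ∇χ(y) ⊗ K(x − y) f(x) dy` -/

section CutoffTerm

variable {K : ℝ³ → V →L[ℝ] W} {A : ℝ}

/-- `mid` is symmetric. [folklore] -/
theorem mid_comm (x x' : ℝ³) : mid x' x = mid x x' := by
  rw [mid, mid, add_comm]

/-- On `B(x₀, ρ/2)` the cutoff-term integrand is unchanged when `K` is replaced by its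
truncation at scale `ρ/4` (pointwise version of `integral_cutoffTerm_truncKernel_eq`). [folklore] -/
theorem cutoffIntegrand_eq_truncKernel (K : ℝ³ → V →L[ℝ] W) {ρ : ℝ} (hρ : 0 < ρ) (x₀ : ℝ³) {x : ℝ³}
    (hx : ‖x - x₀‖ < ρ / 2) (v : V) :
    (fun y => (fderiv ℝ (suppCutoff x₀ ρ) y).smulRight (K (x - y) v)) =
      fun y => (fderiv ℝ (suppCutoff x₀ ρ) y).smulRight (truncKernel K (ρ / 4) (x - y) v) := by
  funext y
  by_cases hy : ‖y - x₀‖ < ρ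
  · simp only [fderiv_suppCutoff_eq_zero hρ hy, ContinuousLinearMap.zero_smulRight]
  · have h1 : 2 * (ρ / 4) ≤ ‖x - y‖ := by
      have : ‖y - x₀‖ ≤ ‖y - x‖ + ‖x - x₀‖ := norm_sub_le_norm_sub_add_norm_sub _ _ _
      rw [norm_sub_rev y x] at this
      linarith [not_lt.1 hy]
    simp only [truncKernel_eq K (by positivity : 0 < ρ / 4) h1]

/-- The cutoff-term integrand is integrable for `x ∈ B(x₀, ρ/2)` (it is continuous with compact
support once `K` is replaced by `K_{ρ/4}`). [folklore] -/
theorem integrable_cutoffIntegrand (hK : IsC1SingularKernel K A) {ρ : ℝ} (hρ : 0 < ρ) (x₀ : ℝ³)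
    {x : ℝ³} (hx : ‖x - x₀‖ < ρ / 2) (v : V) :
    Integrable fun y => (fderiv ℝ (suppCutoff x₀ ρ) y).smulRight (K (x - y) v) := by
  rw [cutoffIntegrand_eq_truncKernel K hρ x₀ hx v]
  have hε : 0 < ρ / 4 := by positivity
  have hχc : ContDiff ℝ 1 (suppCutoff x₀ ρ) := contDiff_suppCutoff x₀ ρ
  have hχs : HasCompactSupport (suppCutoff x₀ ρ) := hasCompactSupport_suppCutoff x₀ hρ
  have hKc : ContDiff ℝ 1 (truncKernel K (ρ / 4)) := contDiff_truncKernel hK hε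
  have hsc : Continuous fun y => (fderiv ℝ (suppCutoff x₀ ρ) y).smulRight (truncKernel K (ρ / 4) (x - y) v) := by
    have h1 : Continuous fun y => ContinuousLinearMap.smulRightL ℝ ℝ³ W (fderiv ℝ (suppCutoff x₀ ρ) y)
        (truncKernel K (ρ / 4) (x - y) v) :=
      ((ContinuousLinearMap.smulRightL ℝ ℝ³ W).continuous.comp (hχc.continuous_fderiv one_ne_zero)).clm_apply
        ((hKc.continuous.comp (continuous_const.sub continuous_id)).clm_apply continuous_const)
    exact h1
  exact hsc.integrable_of_hasCompactSupport ((hχs.fderiv (𝕜 := ℝ)).mono fun y hy => by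
    rw [mem_support] at hy ⊢
    intro h0
    exact hy (by rw [h0, ContinuousLinearMap.zero_smulRight]))

/-- **Pointwise bound for the difference of the cutoff-term integrands**: for
`x, x̄ ∈ B(x₀, ρ/2)` with `‖x − x̄‖ ≤ δ ≤ ρ/8`,
`‖∇χ(y) ⊗ (K(x−y) f x − K(x̄−y) f x̄)‖ ≤ (B/ρ)(64 A M δ ρ⁻³ + 4 A ρ⁻² ‖f x − f x̄‖) 1_{B̄(x₀,2ρ)}(y)`
(`∇χ` lives on `ρ ≤ |y − x₀| ≤ 2ρ`, where `|x̄ − y| > ρ/2`, `|ξ − y| > ρ/2` and the mean value bound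
`norm_kernel_sub_kernel_le` applies). [folklore] -/
theorem norm_cutoffIntegrand_sub_le (hK : IsC1SingularKernel K A) {B : ℝ} (hB0 : 0 ≤ B)
    (hB : ∀ ε : ℝ, 0 < ε → ∀ z : ℝ³, ‖fderiv ℝ (radialCutoff ε (2 * ε)) z‖ ≤ B * ε⁻¹)
    {f : ℝ³ → V} {x₀ : ℝ³} {ρ M : ℝ} (hρ : 0 < ρ) (hM : ∀ y, ‖f y‖ ≤ M) {x x' : ℝ³}
    (hx : ‖x - x₀‖ < ρ / 2) (hx' : ‖x' - x₀‖ < ρ / 2) {δ : ℝ} (hδ0 : 0 < δ) (hδ : ‖x - x'‖ ≤ δ)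
    (hδρ : δ ≤ ρ / 8) (y : ℝ³) :
    ‖(fderiv ℝ (suppCutoff x₀ ρ) y).smulRight (K (x - y) (f x) - K (x' - y) (f x'))‖ ≤
      (B * ρ⁻¹ * (64 * A * δ * (ρ ^ 3)⁻¹ * M + 4 * A * (ρ ^ 2)⁻¹ * ‖f x - f x'‖)) *
        (closedBall x₀ (2 * ρ)).indicator (fun _ => (1 : ℝ)) y := by
  have hA := hK.nonneg
  have hM0 : 0 ≤ M := (norm_nonneg _).trans (hM x)
  by_cases hin : ‖y - x₀‖ < ρ
  · rw [fderiv_suppCutoff_eq_zero hρ hin, ContinuousLinearMap.zero_smulRight, norm_zero]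
    exact mul_nonneg (by positivity) (indicator_nonneg (fun _ _ => zero_le_one) _)
  by_cases hout : 2 * ρ < ‖y - x₀‖
  · rw [fderiv_suppCutoff_eq_zero_of_lt hρ hout, ContinuousLinearMap.zero_smulRight, norm_zero]
    exact mul_nonneg (by positivity) (indicator_nonneg (fun _ _ => zero_le_one) _)
  have hyin : y ∈ closedBall x₀ (2 * ρ) := by
    rw [mem_closedBall, dist_eq_norm]; exact not_lt.1 hout
  rw [indicator_of_mem hyin, mul_one, ContinuousLinearMap.norm_smulRight_apply]
  have hρy : ρ ≤ ‖y - x₀‖ := not_lt.1 hin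
  have hx'y : ρ / 2 < ‖x' - y‖ := by
    have : ‖y - x₀‖ ≤ ‖y - x'‖ + ‖x' - x₀‖ := norm_sub_le_norm_sub_add_norm_sub _ _ _
    rw [norm_sub_rev y x'] at this
    linarith
  have hξy : ρ / 2 < ‖y - mid x x'‖ := by
    have h1 : ‖y - x₀‖ ≤ ‖y - mid x x'‖ + ‖mid x x' - x₀‖ := norm_sub_le_norm_sub_add_norm_sub _ _ _
    linarith [norm_mid_sub_lt hx hx']
  have hδy : δ ≤ ‖y - mid x x'‖ := by linarith
  have h1 : ‖K (x - y) - K (x' - y)‖ ≤ 64 * A * δ * (ρ ^ 3)⁻¹ := by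
    refine (norm_kernel_sub_kernel_le hK hδ0 hδ hδy).trans ?_
    have hm : ρ / 4 ≤ ‖mid x x' - y‖ / 2 := by rw [norm_sub_rev]; linarith
    have : ((‖mid x x' - y‖ / 2) ^ 3)⁻¹ ≤ ((ρ / 4) ^ 3)⁻¹ :=
      inv_anti₀ (by positivity) (pow_le_pow_left₀ (by positivity) hm 3)
    calc A * ((‖mid x x' - y‖ / 2) ^ 3)⁻¹ * ‖x - x'‖ ≤ A * ((ρ / 4) ^ 3)⁻¹ * δ := by gcongr
      _ = 64 * A * δ * (ρ ^ 3)⁻¹ := by field_simp; ring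
  have h2 : ‖K (x' - y)‖ ≤ 4 * A * (ρ ^ 2)⁻¹ := by
    refine (hK.norm_le _).trans ?_
    have : (‖x' - y‖ ^ 2)⁻¹ ≤ ((ρ / 2) ^ 2)⁻¹ :=
      inv_anti₀ (by positivity) (pow_le_pow_left₀ (by positivity) hx'y.le 2)
    calc A * (‖x' - y‖ ^ 2)⁻¹ ≤ A * ((ρ / 2) ^ 2)⁻¹ := by gcongr
      _ = 4 * A * (ρ ^ 2)⁻¹ := by field_simp; ring
  have hsplit : K (x - y) (f x) - K (x' - y) (f x') =
      (K (x - y) - K (x' - y)) (f x) + K (x' - y) (f x - f x') := by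
    rw [sub_apply, map_sub]; abel
  have h3 : ‖K (x - y) (f x) - K (x' - y) (f x')‖ ≤
      64 * A * δ * (ρ ^ 3)⁻¹ * M + 4 * A * (ρ ^ 2)⁻¹ * ‖f x - f x'‖ := by
    rw [hsplit]
    calc ‖(K (x - y) - K (x' - y)) (f x) + K (x' - y) (f x - f x')‖
        ≤ ‖(K (x - y) - K (x' - y)) (f x)‖ + ‖K (x' - y) (f x - f x')‖ := norm_add_le _ _
      _ ≤ ‖K (x - y) - K (x' - y)‖ * ‖f x‖ + ‖K (x' - y)‖ * ‖f x - f x'‖ :=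
          add_le_add (ContinuousLinearMap.le_opNorm _ _) (ContinuousLinearMap.le_opNorm _ _)
      _ ≤ 64 * A * δ * (ρ ^ 3)⁻¹ * M + 4 * A * (ρ ^ 2)⁻¹ * ‖f x - f x'‖ := by
          gcongr
          exact hM x
  calc ‖fderiv ℝ (suppCutoff x₀ ρ) y‖ * ‖K (x - y) (f x) - K (x' - y) (f x')‖
      ≤ (B * ρ⁻¹) * (64 * A * δ * (ρ ^ 3)⁻¹ * M + 4 * A * (ρ ^ 2)⁻¹ * ‖f x - f x'‖) := by
        gcongr
        exact norm_fderiv_suppCutoff_le hB x₀ hρ y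
    _ = _ := by ring

/-- **The cutoff term is Hölder**: for `x, x̄ ∈ B(x₀, ρ/2)`, `‖x − x̄‖ ≤ δ ≤ ρ/8`, `|f| ≤ M`,
`f` `γ`-Hölder with constant `C`,
`‖T₂(x) − T₂(x̄)‖ ≤ (2048π/3) A B M δ/ρ + (128π/3) A B C δ^γ`
(`norm_cutoffIntegrand_sub_le` integrated over `B̄(x₀, 2ρ)`, of volume `32πρ³/3`). [folklore] -/
theorem norm_integral_cutoffTerm_sub_le (hK : IsC1SingularKernel K A) {B : ℝ} (hB0 : 0 ≤ B)
    (hB : ∀ ε : ℝ, 0 < ε → ∀ z : ℝ³, ‖fderiv ℝ (radialCutoff ε (2 * ε)) z‖ ≤ B * ε⁻¹)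
    {γ C : ℝ≥0} {f : ℝ³ → V} (hf : HolderWith C γ f) {x₀ : ℝ³} {ρ M : ℝ} (hρ : 0 < ρ)
    (hM : ∀ y, ‖f y‖ ≤ M) {x x' : ℝ³} (hx : ‖x - x₀‖ < ρ / 2) (hx' : ‖x' - x₀‖ < ρ / 2) {δ : ℝ}
    (hδ0 : 0 < δ) (hδ : ‖x - x'‖ ≤ δ) (hδρ : δ ≤ ρ / 8) :
    ‖(∫ y, (fderiv ℝ (suppCutoff x₀ ρ) y).smulRight (K (x - y) (f x))) -
        ∫ y, (fderiv ℝ (suppCutoff x₀ ρ) y).smulRight (K (x' - y) (f x'))‖ ≤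
      2048 * π / 3 * A * B * M * δ / ρ + 128 * π / 3 * A * B * C * δ ^ (γ : ℝ) := by
  have hA := hK.nonneg
  have hM0 : 0 ≤ M := (norm_nonneg _).trans (hM x)
  have hfx : ‖f x - f x'‖ ≤ C * δ ^ (γ : ℝ) := by
    have h := hf.dist_le x x'
    rw [dist_eq_norm, dist_eq_norm] at h
    exact h.trans (by gcongr)
  rw [← integral_sub (integrable_cutoffIntegrand hK hρ x₀ hx (f x))
    (integrable_cutoffIntegrand hK hρ x₀ hx' (f x'))]
  have hsub : ∀ y, (fderiv ℝ (suppCutoff x₀ ρ) y).smulRight (K (x - y) (f x)) -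
      (fderiv ℝ (suppCutoff x₀ ρ) y).smulRight (K (x' - y) (f x')) =
      (fderiv ℝ (suppCutoff x₀ ρ) y).smulRight (K (x - y) (f x) - K (x' - y) (f x')) := by
    intro y
    ext e
    simp only [sub_apply, ContinuousLinearMap.smulRight_apply, smul_sub]
  simp_rw [hsub]
  set L : ℝ := B * ρ⁻¹ * (64 * A * δ * (ρ ^ 3)⁻¹ * M + 4 * A * (ρ ^ 2)⁻¹ * ‖f x - f x'‖) with hL
  have hL0 : 0 ≤ L := by positivity
  have h1 : ‖∫ y, (fderiv ℝ (suppCutoff x₀ ρ) y).smulRight (K (x - y) (f x) - K (x' - y) (f x'))‖ₑ ≤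
      ENNReal.ofReal (L * (4 / 3 * π * (2 * ρ) ^ 3)) := by
    refine (enorm_integral_le_lintegral_enorm _).trans ?_
    have h2 := lintegral_mono (μ := (volume : Measure ℝ³)) fun y =>
      (show ‖(fderiv ℝ (suppCutoff x₀ ρ) y).smulRight (K (x - y) (f x) - K (x' - y) (f x'))‖ₑ ≤
          ENNReal.ofReal L * (closedBall x₀ (2 * ρ)).indicator (fun _ => (1 : ℝ≥0∞)) y from by
        rw [← ofReal_norm]
        refine (ENNReal.ofReal_le_ofReal
          (norm_cutoffIntegrand_sub_le hK hB0 hB hρ hM hx hx' hδ0 hδ hδρ y)).trans ?_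
        rw [ENNReal.ofReal_mul hL0]
        gcongr
        by_cases hy : y ∈ closedBall x₀ (2 * ρ)
        · rw [indicator_of_mem hy, indicator_of_mem hy, ENNReal.ofReal_one]
        · rw [indicator_of_notMem hy, indicator_of_notMem hy, ENNReal.ofReal_zero])
    refine h2.trans ?_
    rw [lintegral_const_mul _ (measurable_const.indicator measurableSet_closedBall),
      lintegral_indicator measurableSet_closedBall, setLIntegral_const, one_mul,
      EuclideanSpace.volume_closedBall_fin_three,
      ← ENNReal.ofReal_pow (by positivity : (0:ℝ) ≤ 2 * ρ),
      ← ENNReal.ofReal_mul (p := (2 * ρ) ^ 3) (by positivity), ← ENNReal.ofReal_mul hL0]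
    exact ENNReal.ofReal_le_ofReal (le_of_eq (by ring))
  rw [← ofReal_norm] at h1
  refine ((ENNReal.ofReal_le_ofReal_iff (by positivity)).1 h1).trans ?_
  rw [hL]
  calc B * ρ⁻¹ * (64 * A * δ * (ρ ^ 3)⁻¹ * M + 4 * A * (ρ ^ 2)⁻¹ * ‖f x - f x'‖) * (4 / 3 * π * (2 * ρ) ^ 3)
      ≤ B * ρ⁻¹ * (64 * A * δ * (ρ ^ 3)⁻¹ * M + 4 * A * (ρ ^ 2)⁻¹ * (C * δ ^ (γ : ℝ))) *
          (4 / 3 * π * (2 * ρ) ^ 3) := by gcongr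
    _ = 2048 * π / 3 * A * B * M * δ / ρ + 128 * π / 3 * A * B * C * δ ^ (γ : ℝ) := by
        field_simp
        ring

end CutoffTerm

/-! ### Assembly: the local Hölder estimate for `∇v = gradPotential K x₀ ρ f` -/

section Assembly

variable {K : ℝ³ → V →L[ℝ] W} {A : ℝ}

/-- **Local Hölder estimate for the gradient (Gilbarg–Trudinger Lemma 4.4 in cutoff form)**:
for a `C²` singular kernel, `0 < γ < 1`, `f` `γ`-Hölder with constant `C`, `supp f ⊆ B̄(x₀, ρ)`,
`|f| ≤ M`, and `x, x̄ ∈ B(x₀, ρ/2)` with `‖x − x̄‖ ≤ δ ≤ ρ/8`,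
`‖∇v(x) − ∇v(x̄)‖ ≤ 2·A C 4π(3δ)^γ/γ + (96π A C δ^γ/(1−γ) + (8192π/3) A M δ/ρ)
  + (256π/3) A B C δ^γ + ((2048π/3) A B M δ/ρ + (128π/3) A B C δ^γ)`
(near parts at `x` and `x̄`, the far difference `I₁`, the integration-by-parts term `I₂`, the
cutoff term). [cite: GilbargTrudinger2001, §4.3 Lemma 4.4 (4.18)] -/
theorem norm_gradPotential_sub_le (hK : IsC2SingularKernel K A) {B : ℝ} (hB0 : 0 ≤ B)
    (hB : ∀ ε : ℝ, 0 < ε → ∀ z : ℝ³, ‖fderiv ℝ (radialCutoff ε (2 * ε)) z‖ ≤ B * ε⁻¹)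
    {γ C : ℝ≥0} (hγ : 0 < γ) (hγ1 : (γ : ℝ) < 1) {f : ℝ³ → V} (hf : HolderWith C γ f)
    {x₀ : ℝ³} {ρ M : ℝ} (hρ : 0 < ρ) (hsupp : tsupport f ⊆ closedBall x₀ ρ)
    (hM : ∀ y, ‖f y‖ ≤ M) {x x' : ℝ³} (hx : ‖x - x₀‖ < ρ / 2) (hx' : ‖x' - x₀‖ < ρ / 2)
    {δ : ℝ} (hδ0 : 0 < δ) (hδ : ‖x - x'‖ ≤ δ) (hδρ : δ ≤ ρ / 8) :
    ‖gradPotential K x₀ ρ f x - gradPotential K x₀ ρ f x'‖ ≤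
      2 * (A * C * (4 * π * (3 * δ) ^ (γ : ℝ) / γ)) +
      (96 * π * A * C * δ ^ (γ : ℝ) / (1 - γ) + 8192 * π / 3 * A * M * δ / ρ) +
      256 * π / 3 * A * B * (C * δ ^ (γ : ℝ)) +
      (2048 * π / 3 * A * B * M * δ / ρ + 128 * π / 3 * A * B * C * δ ^ (γ : ℝ)) := by
  have hK1 : IsC1SingularKernel K A := hK.toIsC1SingularKernel
  have hA := hK1.nonneg
  have hxξ : ‖x - mid x x'‖ ≤ δ / 2 := by rw [norm_sub_mid]; linarith
  have hx'ξ : ‖x' - mid x x'‖ ≤ δ / 2 := by rw [norm_sub_mid']; linarith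
  have hδ' : ‖x' - x‖ ≤ δ := by rwa [norm_sub_rev]
  have hfx : ‖f x' - f x‖ ≤ C * δ ^ (γ : ℝ) := by
    have h := hf.dist_le x' x
    rw [dist_eq_norm, dist_eq_norm] at h
    exact h.trans (by gcongr)
  -- continuity and support
  have hfc : Continuous f := hf.continuous hγ
  have hfs : HasCompactSupport f := (isCompact_closedBall x₀ ρ).of_isClosed_subset (isClosed_tsupport f) hsupp
  have hχc : Continuous (suppCutoff x₀ ρ) := (contDiff_suppCutoff x₀ ρ (n := 0)).continuous
  have hχs : HasCompactSupport (suppCutoff x₀ ρ) := hasCompactSupport_suppCutoff x₀ hρ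
  have hg : ∀ z : ℝ³, Continuous fun y => f y - suppCutoff x₀ ρ y • f z := fun z =>
    hfc.sub (hχc.smul continuous_const)
  have hgc : ∀ z : ℝ³, HasCompactSupport fun y => f y - suppCutoff x₀ ρ y • f z := by
    intro z
    have h2 : HasCompactSupport fun y => suppCutoff x₀ ρ y • f z := hχs.smul_right
    exact hfs.sub h2
  -- notation
  set ψ : ℝ³ → ℝ := suppCutoff (mid x x') δ with hψ
  set G : ℝ³ → ℝ³ → (ℝ³ →L[ℝ] W) := fun z y =>
    (fderiv ℝ K (z - y)).flip (f y - suppCutoff x₀ ρ y • f z) with hG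
  set T₂ : ℝ³ → (ℝ³ →L[ℝ] W) := fun z =>
    ∫ y, (fderiv ℝ (suppCutoff x₀ ρ) y).smulRight (K (z - y) (f z)) with hT₂
  change ‖((∫ y, G x y) + T₂ x) - ((∫ y, G x' y) + T₂ x')‖ ≤ _
  -- integrability
  have hGi : ∀ z : ℝ³, ‖z - x₀‖ < ρ / 2 → Integrable (G z) := fun z hz =>
    integrable_gradIntegrand hK1 hγ hf hρ hsupp hz
  have hFi : ∀ z : ℝ³, ‖z - mid x x'‖ ≤ δ / 2 → ∀ z' : ℝ³,
      Integrable fun y => (1 - ψ y) • (fderiv ℝ K (z - y)).flip (f y - suppCutoff x₀ ρ y • f z') :=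
    fun z hz z' => integrable_far_piece hK1 hδ0 hz (hg z') (hgc z')
  have hNi : ∀ z : ℝ³, ‖z - x₀‖ < ρ / 2 → ‖z - mid x x'‖ ≤ δ / 2 →
      Integrable fun y => ψ y • G z y := by
    intro z hz hzξ
    refine ((hGi z hz).sub (hFi z hzξ z)).congr (Eventually.of_forall fun y => ?_)
    simp only [hG, Pi.sub_apply]
    rw [sub_smul, one_smul, sub_sub_cancel]
  -- split of `T₁`
  have hT1 : ∀ z : ℝ³, ‖z - x₀‖ < ρ / 2 → ‖z - mid x x'‖ ≤ δ / 2 →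
      ∫ y, G z y = (∫ y, ψ y • G z y) + ∫ y, (1 - ψ y) • G z y := by
    intro z hz hzξ
    rw [← integral_add (hNi z hz hzξ) (hFi z hzξ z)]
    refine integral_congr_ae (Eventually.of_forall fun y => ?_)
    simp only
    rw [← add_smul, add_sub_cancel, one_smul]
  -- the far difference splits as `I₁ + I₂`
  have hPQ : ∀ y, (1 - ψ y) • G x y - (1 - ψ y) • G x' y =
      (1 - ψ y) • ((fderiv ℝ K (x - y) - fderiv ℝ K (x' - y)).flip (f y - suppCutoff x₀ ρ y • f x)) +
        (1 - ψ y) • ((fderiv ℝ K (x' - y)).flip (suppCutoff x₀ ρ y • (f x' - f x))) := by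
    intro y
    rw [← smul_sub, ← smul_add]
    congr 1
    ext e
    simp only [hG, ContinuousLinearMap.flip_apply, sub_apply, add_apply, smul_apply, map_sub,
      map_smul, smul_sub]
    abel
  have hQi : Integrable fun y => (1 - ψ y) • ((fderiv ℝ K (x' - y)).flip (suppCutoff x₀ ρ y • (f x' - f x))) :=
    integrable_far_piece hK1 hδ0 hx'ξ (hχc.smul continuous_const) hχs.smul_right
  have hPi : Integrable fun y => (1 - ψ y) •
      ((fderiv ℝ K (x - y) - fderiv ℝ K (x' - y)).flip (f y - suppCutoff x₀ ρ y • f x)) := by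
    refine (((hFi x hxξ x).sub (hFi x' hx'ξ x')).sub hQi).congr (Eventually.of_forall fun y => ?_)
    have h := hPQ y
    simp only [hG] at h
    simp only [Pi.sub_apply]
    rw [h, add_sub_cancel_right]
  have hfar : (∫ y, (1 - ψ y) • G x y) - ∫ y, (1 - ψ y) • G x' y =
      (∫ y, (1 - ψ y) • ((fderiv ℝ K (x - y) - fderiv ℝ K (x' - y)).flip (f y - suppCutoff x₀ ρ y • f x))) +
        ∫ y, (1 - ψ y) • ((fderiv ℝ K (x' - y)).flip (suppCutoff x₀ ρ y • (f x' - f x))) := by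
    rw [← integral_sub (hFi x hxξ x) (hFi x' hx'ξ x'), ← integral_add hPi hQi]
    exact integral_congr_ae (Eventually.of_forall hPQ)
  -- the five bounds
  have hN : ‖∫ y, ψ y • G x y‖ ≤ A * C * (4 * π * (3 * δ) ^ (γ : ℝ) / γ) :=
    norm_integral_nearGrad_le hK1 hγ hf hρ hx hδ0 hδ hδρ
  have hN' : ‖∫ y, ψ y • G x' y‖ ≤ A * C * (4 * π * (3 * δ) ^ (γ : ℝ) / γ) := by
    have h := norm_integral_nearGrad_le hK1 hγ hf hρ hx' hδ0 hδ' hδρ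
    rw [mid_comm] at h
    exact h
  have hI1 := norm_integral_far_diff_le hK hγ hγ1 hf hρ hsupp hM hx hx' hδ0 hδ
  have hI2 : ‖∫ y, (1 - ψ y) • ((fderiv ℝ K (x' - y)).flip (suppCutoff x₀ ρ y • (f x' - f x)))‖ ≤
      256 * π / 3 * A * B * (C * δ ^ (γ : ℝ)) :=
    (norm_integral_far_ibp_le hK1 hB0 hB hρ hx' hδ0 hδ (f x' - f x)).trans (by gcongr)
  have hT2 := norm_integral_cutoffTerm_sub_le hK1 hB0 hB hf hρ hM hx hx' hδ0 hδ hδρ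
  -- assembly
  have halg : ((∫ y, G x y) + T₂ x) - ((∫ y, G x' y) + T₂ x') =
      ((∫ y, ψ y • G x y) - ∫ y, ψ y • G x' y) +
        ((∫ y, (1 - ψ y) • ((fderiv ℝ K (x - y) - fderiv ℝ K (x' - y)).flip (f y - suppCutoff x₀ ρ y • f x))) +
          ∫ y, (1 - ψ y) • ((fderiv ℝ K (x' - y)).flip (suppCutoff x₀ ρ y • (f x' - f x)))) +
        (T₂ x - T₂ x') := by
    rw [hT1 x hx hxξ, hT1 x' hx' hx'ξ, ← hfar]
    abel
  rw [halg]
  calc ‖((∫ y, ψ y • G x y) - ∫ y, ψ y • G x' y) +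
        ((∫ y, (1 - ψ y) • ((fderiv ℝ K (x - y) - fderiv ℝ K (x' - y)).flip (f y - suppCutoff x₀ ρ y • f x))) +
          ∫ y, (1 - ψ y) • ((fderiv ℝ K (x' - y)).flip (suppCutoff x₀ ρ y • (f x' - f x)))) +
        (T₂ x - T₂ x')‖
      ≤ (‖∫ y, ψ y • G x y‖ + ‖∫ y, ψ y • G x' y‖) +
        (‖∫ y, (1 - ψ y) • ((fderiv ℝ K (x - y) - fderiv ℝ K (x' - y)).flip (f y - suppCutoff x₀ ρ y • f x))‖ +
          ‖∫ y, (1 - ψ y) • ((fderiv ℝ K (x' - y)).flip (suppCutoff x₀ ρ y • (f x' - f x)))‖) +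
        ‖T₂ x - T₂ x'‖ := by
        refine (norm_add_le _ _).trans (add_le_add ((norm_add_le _ _).trans (add_le_add ?_ ?_)) le_rfl)
        · exact norm_sub_le _ _
        · exact norm_add_le _ _
    _ ≤ (A * C * (4 * π * (3 * δ) ^ (γ : ℝ) / γ) + A * C * (4 * π * (3 * δ) ^ (γ : ℝ) / γ)) +
        ((96 * π * A * C * δ ^ (γ : ℝ) / (1 - γ) + 8192 * π / 3 * A * M * δ / ρ) +
          256 * π / 3 * A * B * (C * δ ^ (γ : ℝ))) +
        (2048 * π / 3 * A * B * M * δ / ρ + 128 * π / 3 * A * B * C * δ ^ (γ : ℝ)) := by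
        gcongr
    _ = _ := by ring

end Assembly

/-! ### Sup bounds for the gradient -/

section SupBound

variable {K : ℝ³ → V →L[ℝ] W} {A : ℝ}

/-- **Pointwise bound for the cutoff-term integrand**: for `x ∈ B(x₀, ρ/2)`,
`‖∇χ(y) ⊗ K(x − y) v‖ ≤ 4 A B ρ⁻³ ‖v‖ 1_{B̄(x₀,2ρ)}(y)`. [folklore] -/
theorem norm_cutoffIntegrand_le (hK : IsC1SingularKernel K A) {B : ℝ} (hB0 : 0 ≤ B)
    (hB : ∀ ε : ℝ, 0 < ε → ∀ z : ℝ³, ‖fderiv ℝ (radialCutoff ε (2 * ε)) z‖ ≤ B * ε⁻¹)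
    {x₀ : ℝ³} {ρ : ℝ} (hρ : 0 < ρ) {x : ℝ³} (hx : ‖x - x₀‖ < ρ / 2) (v : V) (y : ℝ³) :
    ‖(fderiv ℝ (suppCutoff x₀ ρ) y).smulRight (K (x - y) v)‖ ≤
      4 * A * B * (ρ ^ 3)⁻¹ * ‖v‖ * (closedBall x₀ (2 * ρ)).indicator (fun _ => (1 : ℝ)) y := by
  have hA := hK.nonneg
  by_cases hin : ‖y - x₀‖ < ρ
  · rw [fderiv_suppCutoff_eq_zero hρ hin, ContinuousLinearMap.zero_smulRight, norm_zero]
    exact mul_nonneg (by positivity) (indicator_nonneg (fun _ _ => zero_le_one) _)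
  by_cases hout : 2 * ρ < ‖y - x₀‖
  · rw [fderiv_suppCutoff_eq_zero_of_lt hρ hout, ContinuousLinearMap.zero_smulRight, norm_zero]
    exact mul_nonneg (by positivity) (indicator_nonneg (fun _ _ => zero_le_one) _)
  have hyin : y ∈ closedBall x₀ (2 * ρ) := by
    rw [mem_closedBall, dist_eq_norm]; exact not_lt.1 hout
  rw [indicator_of_mem hyin, mul_one, ContinuousLinearMap.norm_smulRight_apply]
  have hxy : ρ / 2 < ‖x - y‖ := by
    have : ‖y - x₀‖ ≤ ‖y - x‖ + ‖x - x₀‖ := norm_sub_le_norm_sub_add_norm_sub _ _ _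
    rw [norm_sub_rev y x] at this
    linarith [not_lt.1 hin]
  have h2 : ‖K (x - y)‖ ≤ 4 * A * (ρ ^ 2)⁻¹ := by
    refine (hK.norm_le _).trans ?_
    have : (‖x - y‖ ^ 2)⁻¹ ≤ ((ρ / 2) ^ 2)⁻¹ :=
      inv_anti₀ (by positivity) (pow_le_pow_left₀ (by positivity) hxy.le 2)
    calc A * (‖x - y‖ ^ 2)⁻¹ ≤ A * ((ρ / 2) ^ 2)⁻¹ := by gcongr
      _ = 4 * A * (ρ ^ 2)⁻¹ := by field_simp; ring
  calc ‖fderiv ℝ (suppCutoff x₀ ρ) y‖ * ‖K (x - y) v‖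
      ≤ (B * ρ⁻¹) * (4 * A * (ρ ^ 2)⁻¹ * ‖v‖) := by
        refine mul_le_mul (norm_fderiv_suppCutoff_le hB x₀ hρ y)
          ((ContinuousLinearMap.le_opNorm _ _).trans (by gcongr)) (norm_nonneg _) (by positivity)
    _ = _ := by field_simp

/-- **Sup bound for the cutoff term**: `‖T₂(x)‖ ≤ (128π/3) A B ‖v‖` on `B(x₀, ρ/2)`. [folklore] -/
theorem norm_integral_cutoffTerm_le (hK : IsC1SingularKernel K A) {B : ℝ} (hB0 : 0 ≤ B)
    (hB : ∀ ε : ℝ, 0 < ε → ∀ z : ℝ³, ‖fderiv ℝ (radialCutoff ε (2 * ε)) z‖ ≤ B * ε⁻¹)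
    {x₀ : ℝ³} {ρ : ℝ} (hρ : 0 < ρ) {x : ℝ³} (hx : ‖x - x₀‖ < ρ / 2) (v : V) :
    ‖∫ y, (fderiv ℝ (suppCutoff x₀ ρ) y).smulRight (K (x - y) v)‖ ≤ 128 * π / 3 * A * B * ‖v‖ := by
  have hA := hK.nonneg
  set L : ℝ := 4 * A * B * (ρ ^ 3)⁻¹ * ‖v‖ with hL
  have hL0 : 0 ≤ L := by positivity
  have h1 : ‖∫ y, (fderiv ℝ (suppCutoff x₀ ρ) y).smulRight (K (x - y) v)‖ₑ ≤
      ENNReal.ofReal (L * (4 / 3 * π * (2 * ρ) ^ 3)) := by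
    refine (enorm_integral_le_lintegral_enorm _).trans ?_
    have h2 := lintegral_mono (μ := (volume : Measure ℝ³)) fun y =>
      (show ‖(fderiv ℝ (suppCutoff x₀ ρ) y).smulRight (K (x - y) v)‖ₑ ≤
          ENNReal.ofReal L * (closedBall x₀ (2 * ρ)).indicator (fun _ => (1 : ℝ≥0∞)) y from by
        rw [← ofReal_norm]
        refine (ENNReal.ofReal_le_ofReal (norm_cutoffIntegrand_le hK hB0 hB hρ hx v y)).trans ?_
        rw [ENNReal.ofReal_mul hL0]
        gcongr
        by_cases hy : y ∈ closedBall x₀ (2 * ρ)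
        · rw [indicator_of_mem hy, indicator_of_mem hy, ENNReal.ofReal_one]
        · rw [indicator_of_notMem hy, indicator_of_notMem hy, ENNReal.ofReal_zero])
    refine h2.trans ?_
    rw [lintegral_const_mul _ (measurable_const.indicator measurableSet_closedBall),
      lintegral_indicator measurableSet_closedBall, setLIntegral_const, one_mul,
      EuclideanSpace.volume_closedBall_fin_three,
      ← ENNReal.ofReal_pow (by positivity : (0:ℝ) ≤ 2 * ρ),
      ← ENNReal.ofReal_mul (p := (2 * ρ) ^ 3) (by positivity), ← ENNReal.ofReal_mul hL0]
    exact ENNReal.ofReal_le_ofReal (le_of_eq (by ring))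
  rw [← ofReal_norm] at h1
  refine ((ENNReal.ofReal_le_ofReal_iff (by positivity)).1 h1).trans (le_of_eq ?_)
  rw [hL]
  field_simp
  ring

/-- **Sup bound for the singular first term**: for `x ∈ B(x₀, ρ/2)`,
`‖∫ (∇K(x−y)·)(f y − χ y f x) dy‖ ≤ A C 4π(2ρ)^γ/γ + (256π/3) A M` (the majorant of
`norm_gradIntegrand_le` integrated). [folklore] -/
theorem norm_integral_gradIntegrand_le (hK : IsC1SingularKernel K A) {γ C : ℝ≥0} (hγ : 0 < γ)
    {f : ℝ³ → V} (hf : HolderWith C γ f) {x₀ : ℝ³} {ρ M : ℝ} (hρ : 0 < ρ)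
    (hsupp : tsupport f ⊆ closedBall x₀ ρ) (hM : ∀ y, ‖f y‖ ≤ M) {x : ℝ³} (hx : ‖x - x₀‖ < ρ / 2) :
    ‖∫ y, (fderiv ℝ K (x - y)).flip (f y - suppCutoff x₀ ρ y • f x)‖ ≤
      A * C * (4 * π * (2 * ρ) ^ (γ : ℝ) / γ) + 256 * π / 3 * A * M := by
  have hA := hK.nonneg
  have hM0 : 0 ≤ M := (norm_nonneg _).trans (hM x)
  have hc0 : 0 ≤ A * C := by positivity
  set c₂ : ℝ := 8 * A * M * (ρ ^ 3)⁻¹ with hc₂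
  have hc₂0 : 0 ≤ c₂ := by positivity
  have h1 : ‖∫ y, (fderiv ℝ K (x - y)).flip (f y - suppCutoff x₀ ρ y • f x)‖ₑ ≤
      ENNReal.ofReal (A * C * (4 * π * (2 * ρ) ^ (γ : ℝ) / γ) + c₂ * (4 / 3 * π * (2 * ρ) ^ 3)) := by
    refine (enorm_integral_le_lintegral_enorm _).trans ?_
    have h2 := lintegral_mono (μ := (volume : Measure ℝ³)) fun y =>
      (show ‖(fderiv ℝ K (x - y)).flip (f y - suppCutoff x₀ ρ y • f x)‖ₑ ≤
          ENNReal.ofReal (A * C) * ENNReal.ofReal (holderMajorant γ (2 * ρ) (x - y)) +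
            ENNReal.ofReal c₂ * (closedBall x₀ (2 * ρ)).indicator (fun _ => (1 : ℝ≥0∞)) y from by
        rw [← ofReal_norm]
        refine (ENNReal.ofReal_le_ofReal (norm_gradIntegrand_le hK hf hρ hsupp hM hx y)).trans ?_
        rw [ENNReal.ofReal_add (mul_nonneg hc0 (holderMajorant_nonneg _ _ _))
            (mul_nonneg hc₂0 (indicator_nonneg (fun _ _ => zero_le_one) _)),
          ENNReal.ofReal_mul hc0, ENNReal.ofReal_mul hc₂0]
        gcongr
        by_cases hy : y ∈ closedBall x₀ (2 * ρ)
        · rw [indicator_of_mem hy, indicator_of_mem hy, ENNReal.ofReal_one]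
        · rw [indicator_of_notMem hy, indicator_of_notMem hy, ENNReal.ofReal_zero])
    refine h2.trans ?_
    have hmk : Measurable fun y : ℝ³ => ENNReal.ofReal (holderMajorant γ (2 * ρ) (x - y)) :=
      ((measurable_holderMajorant γ (2 * ρ)).comp (measurable_const.sub measurable_id)).ennreal_ofReal
    have hm₁ : Measurable fun y : ℝ³ => ENNReal.ofReal (A * C) * ENNReal.ofReal (holderMajorant γ (2 * ρ) (x - y)) :=
      hmk.const_mul _
    rw [lintegral_add_left hm₁, lintegral_const_mul _ hmk,
      lintegral_sub_left_eq_self (μ := (volume : Measure ℝ³))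
        (fun z => ENNReal.ofReal (holderMajorant γ (2 * ρ) z)) x,
      lintegral_holderMajorant (by exact_mod_cast hγ) (by positivity),
      lintegral_const_mul _ (measurable_const.indicator measurableSet_closedBall),
      lintegral_indicator measurableSet_closedBall, setLIntegral_const, one_mul,
      EuclideanSpace.volume_closedBall_fin_three,
      ← ENNReal.ofReal_pow (by positivity : (0:ℝ) ≤ 2 * ρ),
      ← ENNReal.ofReal_mul (p := (2 * ρ) ^ 3) (by positivity), ← ENNReal.ofReal_mul hc0,
      ← ENNReal.ofReal_mul hc₂0, ← ENNReal.ofReal_add (by positivity) (by positivity)]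
    exact ENNReal.ofReal_le_ofReal (le_of_eq (by ring))
  rw [← ofReal_norm] at h1
  refine ((ENNReal.ofReal_le_ofReal_iff (by positivity)).1 h1).trans (le_of_eq ?_)
  rw [hc₂]
  field_simp
  ring

/-- **Local sup bound for the gradient**: for `x ∈ B(x₀, ρ/2)`,
`‖∇v(x)‖ ≤ A C 4π(2ρ)^γ/γ + (256π/3) A M + (128π/3) A B M`. [folklore] -/
theorem norm_gradPotential_le (hK : IsC1SingularKernel K A) {B : ℝ} (hB0 : 0 ≤ B)
    (hB : ∀ ε : ℝ, 0 < ε → ∀ z : ℝ³, ‖fderiv ℝ (radialCutoff ε (2 * ε)) z‖ ≤ B * ε⁻¹)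
    {γ C : ℝ≥0} (hγ : 0 < γ) {f : ℝ³ → V} (hf : HolderWith C γ f) {x₀ : ℝ³} {ρ M : ℝ}
    (hρ : 0 < ρ) (hsupp : tsupport f ⊆ closedBall x₀ ρ) (hM : ∀ y, ‖f y‖ ≤ M) {x : ℝ³}
    (hx : ‖x - x₀‖ < ρ / 2) :
    ‖gradPotential K x₀ ρ f x‖ ≤
      A * C * (4 * π * (2 * ρ) ^ (γ : ℝ) / γ) + 256 * π / 3 * A * M + 128 * π / 3 * A * B * M := by
  have hA := hK.nonneg
  unfold gradPotential
  refine (norm_add_le _ _).trans ?_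
  have h1 := norm_integral_gradIntegrand_le hK hγ hf hρ hsupp hM hx
  have h2 := (norm_integral_cutoffTerm_le hK hB0 hB hρ hx (f x)).trans
    (mul_le_mul_of_nonneg_left (hM x) (by positivity))
  linarith

/-- **Far-field bound**: if `x` is at distance `≥ 2R` from the centre of the support ball
`B̄(x₀, R)`, then `‖∇v(x)‖ ≤ (4π/3) A M` (there `f(x) = 0`, the cutoff terms drop out, and
`|x − y| ≥ R` on the support). [folklore] -/
theorem norm_fderiv_singularPotential_le_far (hK : IsC1SingularKernel K A) {γ C : ℝ≥0} (hγ : 0 < γ)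
    {f : ℝ³ → V} (hf : HolderWith C γ f) {x₀ : ℝ³} {R M : ℝ} (hR : 0 < R)
    (hsupp : tsupport f ⊆ closedBall x₀ R) (hM : ∀ y, ‖f y‖ ≤ M) {x : ℝ³} (hx : 2 * R ≤ ‖x - x₀‖) :
    ‖fderiv ℝ (singularPotential K f) x‖ ≤ 4 / 3 * π * A * M := by
  have hA := hK.nonneg
  have hM0 : 0 ≤ M := (norm_nonneg _).trans (hM x)
  set ρ : ℝ := 2 * ‖x - x₀‖ + R with hρdef
  have hρ : 0 < ρ := by positivity
  have hxρ : ‖x - x₀‖ < ρ / 2 := by rw [hρdef]; linarith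
  have hsupp' : tsupport f ⊆ closedBall x₀ ρ :=
    hsupp.trans (closedBall_subset_closedBall (by rw [hρdef]; linarith [norm_nonneg (x - x₀)]))
  have hfx : f x = 0 := by
    by_contra h
    have hxs : x ∈ closedBall x₀ R := hsupp (subset_tsupport f (mem_support.2 h))
    rw [mem_closedBall, dist_eq_norm] at hxs
    linarith
  rw [fderiv_singularPotential hK hγ hf hρ hsupp' hxρ, gradPotential]
  simp only [hfx, smul_zero, sub_zero, map_zero, ContinuousLinearMap.smulRight_zero, integral_zero,
    add_zero]
  -- `‖∫ (∇K(x−y)·)(f y) dy‖ ≤ A R⁻³ M |B̄(x₀, R)|`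
  set L : ℝ := A * (R ^ 3)⁻¹ * M with hL
  have hL0 : 0 ≤ L := by positivity
  have hpt : ∀ y, ‖(fderiv ℝ K (x - y)).flip (f y)‖ ≤ L * (closedBall x₀ R).indicator (fun _ => (1 : ℝ)) y := by
    intro y
    by_cases hy : y ∈ closedBall x₀ R
    · rw [indicator_of_mem hy, mul_one]
      have hxy : R ≤ ‖x - y‖ := by
        rw [mem_closedBall, dist_eq_norm] at hy
        have : ‖x - x₀‖ ≤ ‖x - y‖ + ‖y - x₀‖ := norm_sub_le_norm_sub_add_norm_sub _ _ _
        linarith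
      have hxy0 : x - y ≠ 0 := by
        intro h; rw [h, norm_zero] at hxy; linarith
      calc ‖(fderiv ℝ K (x - y)).flip (f y)‖ ≤ ‖(fderiv ℝ K (x - y)).flip‖ * ‖f y‖ :=
            ContinuousLinearMap.le_opNorm _ _
        _ = ‖fderiv ℝ K (x - y)‖ * ‖f y‖ := by rw [ContinuousLinearMap.opNorm_flip]
        _ ≤ A * (‖x - y‖ ^ 3)⁻¹ * M :=
            mul_le_mul (hK.norm_fderiv_le _ hxy0) (hM y) (norm_nonneg _) (by positivity)
        _ ≤ A * (R ^ 3)⁻¹ * M := by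
            gcongr
    · have hfy : f y = 0 := by
        by_contra h
        exact hy (hsupp (subset_tsupport f (mem_support.2 h)))
      rw [hfy, map_zero, norm_zero, indicator_of_notMem hy, mul_zero]
  have h1 : ‖∫ y, (fderiv ℝ K (x - y)).flip (f y)‖ₑ ≤ ENNReal.ofReal (L * (4 / 3 * π * R ^ 3)) := by
    refine (enorm_integral_le_lintegral_enorm _).trans ?_
    have h2 := lintegral_mono (μ := (volume : Measure ℝ³)) fun y =>
      (show ‖(fderiv ℝ K (x - y)).flip (f y)‖ₑ ≤
          ENNReal.ofReal L * (closedBall x₀ R).indicator (fun _ => (1 : ℝ≥0∞)) y from by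
        rw [← ofReal_norm]
        refine (ENNReal.ofReal_le_ofReal (hpt y)).trans ?_
        rw [ENNReal.ofReal_mul hL0]
        gcongr
        by_cases hy : y ∈ closedBall x₀ R
        · rw [indicator_of_mem hy, indicator_of_mem hy, ENNReal.ofReal_one]
        · rw [indicator_of_notMem hy, indicator_of_notMem hy, ENNReal.ofReal_zero])
    refine h2.trans ?_
    rw [lintegral_const_mul _ (measurable_const.indicator measurableSet_closedBall),
      lintegral_indicator measurableSet_closedBall, setLIntegral_const, one_mul,
      EuclideanSpace.volume_closedBall_fin_three, ← ENNReal.ofReal_pow hR.le,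
      ← ENNReal.ofReal_mul (p := R ^ 3) (by positivity), ← ENNReal.ofReal_mul hL0]
    exact ENNReal.ofReal_le_ofReal (le_of_eq (by ring))
  rw [← ofReal_norm] at h1
  refine ((ENNReal.ofReal_le_ofReal_iff (by positivity)).1 h1).trans (le_of_eq ?_)
  rw [hL]
  field_simp

/-- **Global sup bound for the gradient of the singular potential of a Hölder density**
(Majda–Bertozzi (4.39), sup part: `|∇(K₃ f)|₀ ≤ c(R) ‖f‖_γ`): if `f` is `γ`-Hölder with
constant `C`, `supp f ⊆ B̄(x₀, R)`, `|f| ≤ M`, then for every `x`,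
`‖∇v(x)‖ ≤ A C 4π(8R)^γ/γ + (256π/3) A M + (128π/3) A B M`. [cite: MajdaBertozziCUP2002, §4.1.3 Lemma 4.6 (4.36), (4.39)] -/
theorem norm_fderiv_singularPotential_le (hK : IsC1SingularKernel K A) {B : ℝ} (hB0 : 0 ≤ B)
    (hB : ∀ ε : ℝ, 0 < ε → ∀ z : ℝ³, ‖fderiv ℝ (radialCutoff ε (2 * ε)) z‖ ≤ B * ε⁻¹)
    {γ C : ℝ≥0} (hγ : 0 < γ) {f : ℝ³ → V} (hf : HolderWith C γ f) {x₀ : ℝ³} {R M : ℝ}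
    (hR : 0 < R) (hsupp : tsupport f ⊆ closedBall x₀ R) (hM : ∀ y, ‖f y‖ ≤ M) (x : ℝ³) :
    ‖fderiv ℝ (singularPotential K f) x‖ ≤
      A * C * (4 * π * (8 * R) ^ (γ : ℝ) / γ) + 256 * π / 3 * A * M + 128 * π / 3 * A * B * M := by
  have hA := hK.nonneg
  have hM0 : 0 ≤ M := (norm_nonneg _).trans (hM x)
  by_cases hx : ‖x - x₀‖ < 2 * R
  · have hρ : (0 : ℝ) < 4 * R := by positivity
    have hxρ : ‖x - x₀‖ < 4 * R / 2 := by linarith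
    have hsupp' : tsupport f ⊆ closedBall x₀ (4 * R) :=
      hsupp.trans (closedBall_subset_closedBall (by linarith))
    rw [fderiv_singularPotential hK hγ hf hρ hsupp' hxρ]
    have h := norm_gradPotential_le hK hB0 hB hγ hf hρ hsupp' hM hxρ
    rwa [show 2 * (4 * R) = 8 * R by ring] at h
  · refine (norm_fderiv_singularPotential_le_far hK hγ hf hR hsupp hM (not_lt.1 hx)).trans ?_
    have h1 : 0 ≤ A * C * (4 * π * (8 * R) ^ (γ : ℝ) / γ) := by positivity
    have h2 : 0 ≤ 128 * π / 3 * A * B * M := by positivity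
    have h3 : 0 ≤ π * A * M := by positivity
    linarith

end SupBound

/-! ### The global Hölder estimate for `∇(singularPotential K f)` -/

section Global

variable {K : ℝ³ → V →L[ℝ] W} {A : ℝ}

/-- The constant multiplying the Hölder constant `[f]_γ` in the global gradient estimate:
`8π 3^γ A/γ + 96π A/(1 − γ) + 128π A B`. [folklore] -/
def holderGradConstC (A B γ : ℝ) : ℝ :=
  8 * π * (3 : ℝ) ^ γ * A / γ + 96 * π * A / (1 - γ) + 128 * π * A * B

/-- The constant multiplying `‖f‖_∞ R^{−γ}` in the global gradient estimate:
`(8192π/3) A + (2048π/3) A B`. [folklore] -/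
def holderGradConstM (A B : ℝ) : ℝ :=
  8192 * π / 3 * A + 2048 * π / 3 * A * B

/-- `holderGradConstC A B γ ≥ 0` for `A, B ≥ 0`, `0 < γ < 1`. [folklore] -/
theorem holderGradConstC_nonneg {A B γ : ℝ} (hA : 0 ≤ A) (hB : 0 ≤ B) (hγ : 0 < γ) (hγ1 : γ < 1) :
    0 ≤ holderGradConstC A B γ := by
  unfold holderGradConstC
  have : 0 < 1 - γ := by linarith
  positivity

/-- `holderGradConstM A B ≥ 0` for `A, B ≥ 0`. [folklore] -/
theorem holderGradConstM_nonneg {A B : ℝ} (hA : 0 ≤ A) (hB : 0 ≤ B) : 0 ≤ holderGradConstM A B := by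
  unfold holderGradConstM
  positivity

/-- **Global Hölder estimate for the gradient of the singular potential of a Hölder density**
(Majda–Bertozzi §4.1.3 Lemma 4.6, (4.36) `|P_N f|_γ ≤ c‖f‖_γ` with (4.49), i.e. (4.39)
`|K₃ f|_{1,γ} ≤ c‖f‖_γ`, Hölder part; Gilbarg–Trudinger Lemma 4.4): for a `C²` singular kernel
of degree `−2` with constant `A`, the cutoff constant `B`, `0 < γ < 1`, and `f` `γ`-Hölder with
constant `C`, `supp f ⊆ B̄(x₀, R)`, `|f| ≤ M`: for all `x, x̄`,
`‖∇v(x) − ∇v(x̄)‖ ≤ (c₁(A,B,γ) C + c₂(A,B) M R^{−γ}) ‖x − x̄‖^γ`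
(`norm_gradPotential_sub_le` on the ball `B(x₀, ρ/2)` with
`ρ = 8‖x − x̄‖ + R + 2‖x − x₀‖ + 2‖x̄ − x₀‖`, whose `δ/ρ`-terms are `≤ δ^γ R^{−γ}`). Since a
compactly supported `f` satisfies `‖f‖_∞ ≤ [f]_γ (2R)^γ`, this is the printed `R`-independent
form `|P_N f|_γ ≤ c |f|_γ` ((4.90)) up to the value of `c`; the statement here keeps `‖f‖_∞`
explicit. [cite: MajdaBertozziCUP2002, §4.1.3 Lemma 4.6 (4.36), (4.39)] -/
theorem norm_fderiv_singularPotential_sub_le (hK : IsC2SingularKernel K A) {B : ℝ} (hB0 : 0 ≤ B)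
    (hB : ∀ ε : ℝ, 0 < ε → ∀ z : ℝ³, ‖fderiv ℝ (radialCutoff ε (2 * ε)) z‖ ≤ B * ε⁻¹)
    {γ C : ℝ≥0} (hγ : 0 < γ) (hγ1 : (γ : ℝ) < 1) {f : ℝ³ → V} (hf : HolderWith C γ f)
    {x₀ : ℝ³} {R M : ℝ} (hR : 0 < R) (hsupp : tsupport f ⊆ closedBall x₀ R)
    (hM : ∀ y, ‖f y‖ ≤ M) (x x' : ℝ³) :
    ‖fderiv ℝ (singularPotential K f) x - fderiv ℝ (singularPotential K f) x'‖ ≤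
      (holderGradConstC A B γ * C + holderGradConstM A B * M * (R ^ (γ : ℝ))⁻¹) *
        ‖x - x'‖ ^ (γ : ℝ) := by
  have hK1 : IsC1SingularKernel K A := hK.toIsC1SingularKernel
  have hA := hK1.nonneg
  have hM0 : 0 ≤ M := (norm_nonneg _).trans (hM x)
  have hγ' : (0 : ℝ) < γ := by exact_mod_cast hγ
  rcases eq_or_ne x x' with rfl | hne
  · rw [sub_self, norm_zero, sub_self, norm_zero, Real.zero_rpow hγ'.ne', mul_zero]
  set δ : ℝ := ‖x - x'‖ with hδdef
  have hδ0 : 0 < δ := norm_pos_iff.2 (sub_ne_zero.2 hne)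
  set ρ : ℝ := 8 * δ + R + 2 * ‖x - x₀‖ + 2 * ‖x' - x₀‖ with hρdef
  have hρ : 0 < ρ := by positivity
  have hx : ‖x - x₀‖ < ρ / 2 := by rw [hρdef]; linarith [norm_nonneg (x' - x₀)]
  have hx' : ‖x' - x₀‖ < ρ / 2 := by rw [hρdef]; linarith [norm_nonneg (x - x₀)]
  have hRρ : R ≤ ρ := by rw [hρdef]; linarith [norm_nonneg (x' - x₀), norm_nonneg (x - x₀)]
  have hδρ : δ ≤ ρ / 8 := by rw [hρdef]; linarith [norm_nonneg (x' - x₀), norm_nonneg (x - x₀)]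
  have hsupp' : tsupport f ⊆ closedBall x₀ ρ := hsupp.trans (closedBall_subset_closedBall hRρ)
  rw [fderiv_singularPotential hK1 hγ hf hρ hsupp' hx, fderiv_singularPotential hK1 hγ hf hρ hsupp' hx']
  refine (norm_gradPotential_sub_le hK hB0 hB hγ hγ1 hf hρ hsupp' hM hx hx' hδ0 le_rfl hδρ).trans ?_
  -- `δ/ρ ≤ δ^γ R^{-γ}`
  have hq : δ / ρ ≤ δ ^ (γ : ℝ) * (R ^ (γ : ℝ))⁻¹ := by
    have hq1 : δ / ρ ≤ 1 := by rw [div_le_one hρ]; linarith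
    have hq0 : 0 < δ / ρ := by positivity
    calc δ / ρ = (δ / ρ) ^ (1 : ℝ) := (Real.rpow_one _).symm
      _ ≤ (δ / ρ) ^ (γ : ℝ) := Real.rpow_le_rpow_of_exponent_ge hq0 hq1 hγ1.le
      _ = δ ^ (γ : ℝ) / ρ ^ (γ : ℝ) := Real.div_rpow hδ0.le hρ.le _
      _ ≤ δ ^ (γ : ℝ) / R ^ (γ : ℝ) := by
          gcongr
      _ = δ ^ (γ : ℝ) * (R ^ (γ : ℝ))⁻¹ := div_eq_mul_inv _ _
  have h3 : (3 * δ) ^ (γ : ℝ) = (3 : ℝ) ^ (γ : ℝ) * δ ^ (γ : ℝ) := Real.mul_rpow (by norm_num) hδ0.le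
  have h1γ : 0 < 1 - (γ : ℝ) := by linarith
  -- regroup
  have hE : 2 * (A * C * (4 * π * (3 * δ) ^ (γ : ℝ) / γ)) +
      (96 * π * A * C * δ ^ (γ : ℝ) / (1 - γ) + 8192 * π / 3 * A * M * δ / ρ) +
      256 * π / 3 * A * B * (C * δ ^ (γ : ℝ)) +
      (2048 * π / 3 * A * B * M * δ / ρ + 128 * π / 3 * A * B * C * δ ^ (γ : ℝ)) =
      δ ^ (γ : ℝ) * (holderGradConstC A B γ * C) + (δ / ρ) * (holderGradConstM A B * M) := by
    rw [h3, holderGradConstC, holderGradConstM]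
    ring
  rw [hE]
  calc δ ^ (γ : ℝ) * (holderGradConstC A B γ * C) + (δ / ρ) * (holderGradConstM A B * M)
      ≤ δ ^ (γ : ℝ) * (holderGradConstC A B γ * C) + (δ ^ (γ : ℝ) * (R ^ (γ : ℝ))⁻¹) * (holderGradConstM A B * M) := by
        have : 0 ≤ holderGradConstM A B * M := mul_nonneg (holderGradConstM_nonneg hA hB0) hM0
        gcongr
    _ = _ := by ring

/-- The same estimate as a `HolderWith` statement. [folklore] -/
theorem holderWith_fderiv_singularPotential (hK : IsC2SingularKernel K A) {B : ℝ} (hB0 : 0 ≤ B)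
    (hB : ∀ ε : ℝ, 0 < ε → ∀ z : ℝ³, ‖fderiv ℝ (radialCutoff ε (2 * ε)) z‖ ≤ B * ε⁻¹)
    {γ C : ℝ≥0} (hγ : 0 < γ) (hγ1 : (γ : ℝ) < 1) {f : ℝ³ → V} (hf : HolderWith C γ f)
    {x₀ : ℝ³} {R M : ℝ} (hR : 0 < R) (hsupp : tsupport f ⊆ closedBall x₀ R)
    (hM : ∀ y, ‖f y‖ ≤ M) :
    HolderWith (Real.toNNReal (holderGradConstC A B γ * C + holderGradConstM A B * M * (R ^ (γ : ℝ))⁻¹))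
      γ (fderiv ℝ (singularPotential K f)) := by
  have hA := hK.toIsC1SingularKernel.nonneg
  have hM0 : 0 ≤ M := (norm_nonneg _).trans (hM x₀)
  have hL : 0 ≤ holderGradConstC A B γ * C + holderGradConstM A B * M * (R ^ (γ : ℝ))⁻¹ := by
    have := holderGradConstC_nonneg hA hB0 (by exact_mod_cast hγ : (0 : ℝ) < γ) hγ1
    have := holderGradConstM_nonneg hA hB0
    positivity
  intro x y
  rw [edist_dist, edist_dist, ENNReal.ofReal_rpow_of_nonneg dist_nonneg γ.coe_nonneg,
    ← ENNReal.ofReal_coe_nnreal, ← ENNReal.ofReal_mul (NNReal.coe_nonneg _), Real.coe_toNNReal _ hL,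
    dist_eq_norm, dist_eq_norm]
  exact ENNReal.ofReal_le_ofReal
    (norm_fderiv_singularPotential_sub_le hK hB0 hB hγ hγ1 hf hR hsupp hM x y)

end Global




end Literature.Analysis.FluidPDE
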